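import Literature.Barriers.PneNP.NOFLogNBarrierProofs
import Mathlib.Analysis.SpecialFunctions.Log.Base
import Mathlib.Data.ZMod.Basic
import Mathlib.Order.WellFounded
import HarnessLib

/-!
# Barrier `NOFLogNBarrier` (Ada–Chattopadhyay–Fawzi–Nguyen, Thm. 2): the protocols, proved

D-0014 discharge of the named fact `Literature.Barriers.PneNP.NOFLogNBarrier`
(`NOFLogNBarrier.lean`): "Let `f : {0,1}ⁿ → {±1}` be a symmetric function,
`g : {0,1}^k → {0,1}` an arbitrary function, and `g⃗ = (g₁, …, g_n)` a vector of `n` functions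
`gᵢ : {0,1}^k → {0,1}`. Then (a) `D_k(f ∘ g⃗) ≤ O(n/2^k · log n + k log n)`, (b) for
`k > 1 + log n`: `D_k^∥(f ∘ g) ≤ O(log³ n)`, (c) for `k > 1 + 2 log n`:
`D_k^∥(f ∘ g⃗) ≤ O(log³ n)`" — over the tree's model (`NOFProtocol`, `SimultaneousProtocol`,
`composeNOF`, `IsSymmetricFn`; costs = numbers of bits; one absolute constant, here `c = 64`;
`log = log₂`; `k, n ≥ 2`): `NOFLogNBarrier_holds`.

**Sources and what is proved.** [AdaEtAl2014] A. Ada, A. Chattopadhyay, O. Fawzi, P. Nguyen,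
*The NOF multiparty communication complexity of composed functions* — the held 12-page
version (`lit read paper:doi-10-1007-s00037-013-0078-4`; §3.1, Lemma 2 and Thm. 2 with its
proof outline, PDF pp. 6–7) and the full version it refers to for the details
("see [1, Theorem 3.2]"), ECCC TR11-155 (fetched by `lit read`, key `paper:url-6af590680442`;
Lemma 3.1 and Thm. 3.2 with its complete proof, pp. 10–12, eqs. (1)–(6)). The proof below
follows the printed proof of Thm. 3.2:

* *Step 2 / the telescoping identity* (full version p. 11, eqs. (1)–(4); p. 12, eq. (6)):
  along a shortest cube path `v = w₁, …, w_t = u`, `1_j(v) = Σᵢ (-1)^{i+1}(1_j(wᵢ) + 1_j(wᵢ₊₁))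
  + (-1)^{t+1} 1_j(u)`, and "each term `1_j(wᵢ) + 1_j(wᵢ₊₁)` is known by some player because
  `wᵢ` and `wᵢ₊₁` differ only in one coordinate". Here: `ACFN.cube_telescope` for the canonical
  path switching the differing coordinates in increasing order (`ACFN.Hybrid`, `ACFN.EdgeSeen`,
  `ACFN.flips`; proved through the partial sums `ACFN.cube_telescope_aux`), the players' parts
  `ACFN.edgePart` and their sum `ACFN.sum_edgePart` = `[g_j(y)] - ĉ_j [y = u]` with
  `ĉ_j = Σ_{v ∈ S_j} (-1)^{d(u,v)}` (`ACFN.topCoeff`, the paper's coefficient `c_j` before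
  reduction mod `n + 1`).
* *Part (a)* (full version pp. 10–12): step 1 is rendered with ONE speaker instead of two —
  player `0` (who sees rows `1 … k-1`) announces the least frequent tail `u' ∈ {0,1}^{k-1}`
  (`ACFN.rareTail`, at most `⌊n/2^{k-1}⌋` occurrences by averaging, `ACFN.tailCount_rareTail_le`)
  together with the list of the columns carrying it (`ACFN.annA`, `(k-1) + ⌈log₂(n+1)⌉⌊n/2^{k-1}⌋`
  bits, `ACFN.card_annType_le`); off the list the vertex `u = 0·u'` is missing, on the list
  player `1` (who sees row `0`) knows the columns exactly; then every player announces her part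
  mod `n + 1` (`ACFN.msgA`, `ACFN.sum_msgAInt`, `ACFN.composeNOF_eq_of_msgA_eq`). Cost
  `(k-1) + ⌈log₂(n+1)⌉⌊n/2^{k-1}⌋ + k⌈log₂(n+1)⌉` (`ACFN.hasNOFProtocol_composeNOF`) — the
  paper's two-speaker step 1 saves a factor `2` in the middle term, immaterial for `O(·)`.
  The blackboard protocol is assembled from generic combinators (`NOFProtocol.announceBits`,
  `NOFProtocol.announceNum`, `NOFProtocol.announceNums`, `hasNOFProtocol_of_determined₂`:
  an announcement followed by one round of numbers that together DETERMINE the value gives a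
  valid protocol whose output node is the value of any consistent input).
* *Lemma 3.1* ([BabaiGalKimmelLokam2003, Lemma 6.10], quoted as ACFN Lemma 2 / Lemma 3.1):
  proved here in the sharp weighted form the proof of (c) uses (`ACFN.bgkl_player_sum`: summing
  over the players the weight of the columns showing hidden-row weight `w` gives
  `(ℓ - w) N_w + (w + 1) N_{w+1}`; `ACFN.bgkl_unique`: two weighted column families of total
  weight `< 2^{ℓ-1}` each with the same statistics have the same weight histogram, via
  `δ_w = (-1)^w C(ℓ,w) δ₀` and `|δ₀| 2^ℓ = Σ|δ_w| < 2^ℓ`).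
* *Parts (b), (c)* (full version p. 12): only the first `ℓ` players speak, the rows `≥ ℓ`
  induce `g'_j` (`ACFN.innerFn`), `u = 0⃗`, the parts are summed over all columns
  (`ACFN.sum_partBC` = number of good columns minus `Σ_j ĉ_j 1_j(0⃗)`, `ACFN.corrBC`), and the
  correction is recovered from the weighted number of all-zero heads, which Lemma 3.1 extracts
  from the speakers' statistics (`ACFN.hasSimultaneousProtocol_engine`, on top of the tree's
  `hasSimultaneousProtocol_of_determined`). (c): `ℓ = ⌈log₂(n²+1)⌉ + 1`, multiplicities
  `c_j = ĉ_j mod (n+1) ≤ n` of total `≤ n² < 2^{ℓ-1}` — the duplicated matrix `X'`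
  (`ACFN.hasSimultaneousProtocol_composeNOF_vec`, cost `ℓ(ℓ+1)⌈log₂(n²+1)⌉`). (b): for
  `k ≥ ℓ` by (c); for `1 + log₂ n < k < ℓ` all `k` players speak, `g'_j = g`, `c_j = 1` and
  `ĉ · n_{0⃗}` is the correction (`ACFN.hasSimultaneousProtocol_composeNOF_single`, cost
  `k(k+1)⌈log₂(n+1)⌉`).
* *Bookkeeping* (`ACFN.costA_le`, `ACFN.costB_le`, `ACFN.costC_le`): `⌈log₂(m+1)⌉ =
  Nat.size m ≤ log₂ m + 1`, `1 ≤ log₂ n` for `n ≥ 2`; the three costs are at most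
  `4 (n/2^k) log₂ n + 3 k log₂ n`, `24 log₂³ n` and `60 log₂³ n`, whence `c = 64`.

Design notes: integers mod `n + 1` are compared in `ZMod (n + 1)`; indicator functions are
`if · then (1 : ℤ) else 0`; the referee / output node is obtained abstractly from "equal
messages ⇒ equal value" exactly as in `NOFLogNBarrierProofs.lean`. Nothing here is specific
to the barrier reading; randomized complexities are not touched.

## Sources

* [AdaEtAl2014] PDF pp. 6–7 (§3.1: Lemma 2, Thm. 2 and proof outline) — held; full version
  ECCC TR11-155 pp. 10–12 (Lemma 3.1, Thm. 3.2 and its proof, eqs. (1)–(6)) — fetched and read.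
* [BabaiGalKimmelLokam2003] Lemma 6.10 — not held (acq-00837); statement through
  [AdaEtAl2014, Lemma 2 / Lemma 3.1]; proved here independently (`ACFN.bgkl_unique`).
* [Jukna2012] Ch. 5 (PDF p. 155: the blackboard model) — through `NOFLogNBarrier.lean`.
-/

noncomputable section

namespace Literature.Barriers.PneNP

open Finset

/-! ### Deterministic protocol combinators: announcing words and numbers -/

namespace NOFProtocol

variable {k n : ℕ}

/-- **Announcing a word.** Player `i` writes the `L` bits of `m X` on the board, one `speak`
node per bit; the protocol then continues with `cont w` on the written word `w`. [folklore] -/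
def announceBits (i : Fin k) : (L : ℕ) → (NOFInput k n → Fin L → Bool) →
    ((Fin L → Bool) → NOFProtocol k n) → NOFProtocol k n
  | 0, _, cont => cont fun b => b.elim0
  | L + 1, m, cont =>
      speak i (fun X => m X 0)
        (announceBits i L (fun X => Fin.tail (m X)) fun w => cont (Fin.cons false w))
        (announceBits i L (fun X => Fin.tail (m X)) fun w => cont (Fin.cons true w))

/-- After the word is written the protocol is `cont (m X)`. [folklore] -/
theorem eval_announceBits (i : Fin k) : ∀ (L : ℕ) (m : NOFInput k n → Fin L → Bool)
    (cont : (Fin L → Bool) → NOFProtocol k n) (X : NOFInput k n),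
    (announceBits i L m cont).eval X = (cont (m X)).eval X
  | 0, m, cont, X => by
      have h : m X = fun b => b.elim0 := funext fun b => b.elim0
      rw [h]
      rfl
  | L + 1, m, cont, X => by
      simp only [announceBits, eval]
      rw [eval_announceBits i L, eval_announceBits i L]
      have key : ∀ w : Fin (L + 1) → Bool,
          (if w 0 = true then (cont (Fin.cons true (Fin.tail w))).eval X
            else (cont (Fin.cons false (Fin.tail w))).eval X) = (cont w).eval X := by
        intro w
        conv_rhs => rw [← Fin.cons_self_tail w]
        rcases Bool.eq_false_or_eq_true (w 0) with h | h <;> simp [h]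
      exact key (m X)

/-- Announcing `L` bits costs `L` plus the worst continuation. [folklore] -/
theorem cost_announceBits_le (i : Fin k) {c : ℕ} : ∀ (L : ℕ) (m : NOFInput k n → Fin L → Bool)
    (cont : (Fin L → Bool) → NOFProtocol k n), (∀ w, (cont w).cost ≤ c) →
    (announceBits i L m cont).cost ≤ L + c
  | 0, m, cont, h => by simpa [announceBits] using h _
  | L + 1, m, cont, h => by
      simp only [announceBits, cost]
      have h0 := cost_announceBits_le i L (fun X => Fin.tail (m X))
        (fun w => cont (Fin.cons false w)) fun w => h _
      have h1 := cost_announceBits_le i L (fun X => Fin.tail (m X))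
        (fun w => cont (Fin.cons true w)) fun w => h _
      omega

/-- Announcing a word that does not depend on the speaker's row is valid. [folklore] -/
theorem valid_announceBits (i : Fin k) : ∀ (L : ℕ) (m : NOFInput k n → Fin L → Bool)
    (cont : (Fin L → Bool) → NOFProtocol k n), IndepOfRow i m → (∀ w, (cont w).Valid) →
    (announceBits i L m cont).Valid
  | 0, m, cont, _, h => by simpa [announceBits] using h _
  | L + 1, m, cont, hm, h => by
      simp only [announceBits, Valid]
      refine ⟨fun X r => ?_, valid_announceBits i L _ _ (fun X r => ?_) fun w => h _,
        valid_announceBits i L _ _ (fun X r => ?_) fun w => h _⟩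
      · show m (Function.update X i r) 0 = m X 0
        rw [hm X r]
      · show Fin.tail (m (Function.update X i r)) = Fin.tail (m X)
        rw [hm X r]
      · show Fin.tail (m (Function.update X i r)) = Fin.tail (m X)
        rw [hm X r]

/-- **Announcing a number** below `2^B`: its `B` binary digits. [folklore] -/
def announceNum (i : Fin k) (B : ℕ) (m : NOFInput k n → ℕ) (cont : ℕ → NOFProtocol k n) :
    NOFProtocol k n :=
  announceBits i B (fun X b => (m X).testBit b) fun w => cont (decodeBits w)

/-- After the number is written the protocol is `cont (m X)`. [folklore] -/
theorem eval_announceNum (i : Fin k) (B : ℕ) (m : NOFInput k n → ℕ) (cont : ℕ → NOFProtocol k n)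
    (X : NOFInput k n) (hm : m X < 2 ^ B) :
    (announceNum i B m cont).eval X = (cont (m X)).eval X := by
  unfold announceNum
  rw [eval_announceBits]
  show (cont (decodeBits fun b : Fin B => (m X).testBit b)).eval X = _
  rw [decodeBits_testBit B (m X) hm]

/-- Announcing a number below `2^B` costs `B` plus the worst continuation. [folklore] -/
theorem cost_announceNum_le (i : Fin k) (B : ℕ) (m : NOFInput k n → ℕ)
    (cont : ℕ → NOFProtocol k n) {c : ℕ} (h : ∀ a, (cont a).cost ≤ c) :
    (announceNum i B m cont).cost ≤ B + c :=
  cost_announceBits_le i B _ _ fun _ => h _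

/-- Announcing a number that does not depend on the speaker's row is valid. [folklore] -/
theorem valid_announceNum (i : Fin k) (B : ℕ) (m : NOFInput k n → ℕ)
    (cont : ℕ → NOFProtocol k n) (hm : IndepOfRow i m) (h : ∀ a, (cont a).Valid) :
    (announceNum i B m cont).Valid :=
  valid_announceBits i B _ _ (fun X r => by
    funext b
    show (m (Function.update X i r)).testBit b = (m X).testBit b
    rw [hm X r]) fun _ => h _

/-- **A round of announcements**: the listed players announce their numbers in turn (each in
`B` bits); the continuation receives the vector of announced numbers (`0` for players not in
the list). [folklore] -/
def announceNums (B : ℕ) (m : Fin k → NOFInput k n → ℕ) :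
    List (Fin k) → ((Fin k → ℕ) → NOFProtocol k n) → NOFProtocol k n
  | [], cont => cont fun _ => 0
  | p :: ps, cont =>
      announceNum p B (m p) fun a => announceNums B m ps fun M => cont (Function.update M p a)

/-- After the round the protocol is the continuation on the true numbers. [folklore] -/
theorem eval_announceNums (B : ℕ) (m : Fin k → NOFInput k n → ℕ) (X : NOFInput k n)
    (hm : ∀ p, m p X < 2 ^ B) : ∀ (ps : List (Fin k)) (cont : (Fin k → ℕ) → NOFProtocol k n),
    (announceNums B m ps cont).eval X = (cont fun p => if p ∈ ps then m p X else 0).eval X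
  | [], cont => by simp [announceNums]
  | p :: ps, cont => by
      rw [announceNums, eval_announceNum _ _ _ _ _ (hm p), eval_announceNums B m X hm ps]
      congr 2
      funext q
      by_cases hq : q = p
      · subst hq
        simp
      · simp [hq]

/-- A round over `ps` costs `|ps| · B` plus the worst continuation. [folklore] -/
theorem cost_announceNums_le (B : ℕ) (m : Fin k → NOFInput k n → ℕ) {c : ℕ} :
    ∀ (ps : List (Fin k)) (cont : (Fin k → ℕ) → NOFProtocol k n), (∀ M, (cont M).cost ≤ c) →
    (announceNums B m ps cont).cost ≤ ps.length * B + c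
  | [], cont, h => by simpa [announceNums] using h _
  | p :: ps, cont, h => by
      rw [announceNums]
      have h1 := cost_announceNum_le p B (m p)
        (fun a => announceNums B m ps fun M => cont (Function.update M p a))
        (fun a => cost_announceNums_le B m ps _ fun M => h _)
      calc _ ≤ B + (ps.length * B + c) := h1
        _ = (p :: ps).length * B + c := by simp only [List.length_cons]; ring

/-- A round of row-independent announcements is valid. [folklore] -/
theorem valid_announceNums (B : ℕ) (m : Fin k → NOFInput k n → ℕ)
    (hm : ∀ p, IndepOfRow p (m p)) :
    ∀ (ps : List (Fin k)) (cont : (Fin k → ℕ) → NOFProtocol k n), (∀ M, (cont M).Valid) →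
    (announceNums B m ps cont).Valid
  | [], cont, h => by simpa [announceNums] using h _
  | p :: ps, cont, h =>
      valid_announceNum p B (m p) _ (hm p) fun _ => valid_announceNums B m hm ps _ fun M => h _

end NOFProtocol

/-- **Two-round deterministic protocols, abstractly.** Player `i₀` announces a value in a
finite type `α` with `|α| ≤ 2^{B₀}` (in `B₀` bits) that does not depend on her row; then every
player `p` announces a number `< 2^B` that may depend on the announced value and does not
depend on row `p`; if these data DETERMINE `F(X)`, then `D_k(F) ≤ B₀ + k·B` (the board
determines the output: the referee-free output node is `F` of any consistent input).
[cite: Jukna2012, Ch. 5 (PDF p. 155)] -/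
theorem hasNOFProtocol_of_determined₂ {k n : ℕ} {α : Type} [Fintype α]
    (F : NOFInput k n → Bool) (i₀ : Fin k) (B₀ B : ℕ) (hα : Fintype.card α ≤ 2 ^ B₀)
    (m₀ : NOFInput k n → α) (h₀ : IndepOfRow i₀ m₀)
    (msg : α → Fin k → NOFInput k n → ℕ) (hmsg : ∀ a p, IndepOfRow p (msg a p))
    (hb : ∀ a p X, msg a p X < 2 ^ B)
    (hdet : ∀ X X', m₀ X = m₀ X' → (∀ p, msg (m₀ X) p X = msg (m₀ X) p X') → F X = F X') :
    HasNOFProtocol F (B₀ + k * B) := by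
  classical
  let e : α ≃ Fin (Fintype.card α) := Fintype.equivFin α
  let msg' : ℕ → Fin k → NOFInput k n → ℕ := fun a p X =>
    if h : a < Fintype.card α then msg (e.symm ⟨a, h⟩) p X else 0
  have hmsg' : ∀ x : α, msg' (e x) = msg x := by
    intro x
    funext p X
    simp [msg', (e x).2]
  let out : ℕ → (Fin k → ℕ) → Bool := fun a M =>
    if h : ∃ X, ((e (m₀ X) : ℕ) = a) ∧ (fun p => msg (m₀ X) p X) = M then F (Classical.choose h)
    else false
  let P : NOFProtocol k n :=
    NOFProtocol.announceNum i₀ B₀ (fun X => (e (m₀ X) : ℕ)) fun a =>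
      NOFProtocol.announceNums B (msg' a) (List.finRange k) fun M => NOFProtocol.output (out a M)
  refine ⟨P, ?_, ?_, ?_⟩
  · refine NOFProtocol.valid_announceNum _ _ _ _ (fun X r => ?_) fun a => ?_
    · show ((e (m₀ (Function.update X i₀ r)) : ℕ)) = (e (m₀ X) : ℕ)
      rw [h₀ X r]
    · refine NOFProtocol.valid_announceNums _ _ (fun p X r => ?_) _ _ fun _ => trivial
      simp only [msg']
      split_ifs with h
      · exact hmsg _ p X r
      · rfl
  · refine (NOFProtocol.cost_announceNum_le _ _ _ _ fun a => ?_).trans (le_of_eq rfl)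
    have := NOFProtocol.cost_announceNums_le B (msg' a) (List.finRange k)
      (fun M => NOFProtocol.output (out a M)) (c := 0) fun _ => le_rfl
    simpa [List.length_finRange] using this
  · intro X
    have hlt : (e (m₀ X) : ℕ) < 2 ^ B₀ := lt_of_lt_of_le (e (m₀ X)).2 hα
    show P.eval X = F X
    simp only [P]
    rw [NOFProtocol.eval_announceNum _ _ _ _ _ hlt, hmsg',
      NOFProtocol.eval_announceNums _ _ _ (fun p => hb _ p X)]
    simp only [List.mem_finRange, if_true, NOFProtocol.eval_output]
    have hex : ∃ X', ((e (m₀ X') : ℕ) = (e (m₀ X) : ℕ)) ∧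
        (fun p => msg (m₀ X') p X') = fun p => msg (m₀ X) p X := ⟨X, rfl, rfl⟩
    simp only [out, dif_pos hex]
    obtain ⟨h1, h2⟩ := Classical.choose_spec hex
    have h1' : m₀ (Classical.choose hex) = m₀ X := e.injective (Fin.ext h1)
    refine hdet _ _ h1' fun p => ?_
    have := congrFun h2 p
    rw [h1'] at this ⊢
    exact this

namespace ACFN

/-! ### The cube telescoping identity (Grolmusz; ACFN eqs. (1), (4), (6)) -/

section Cube

variable {m : ℕ}

/-- The `t`-th vertex of the canonical cube path from `v` to `u` (coordinates below `t` already
switched to `u`) is the column `y`. [cite: AdaEtAl2014, proof of Thm. 2 (PDF pp. 6–7)] -/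
def Hybrid (u v y : Fin m → Bool) (t : ℕ) : Prop :=
  ∀ q : Fin m, y q = if (q : ℕ) < t then u q else v q

/-- `Hybrid` is decidable (a finite conjunction of Boolean equalities). [folklore] -/
instance Hybrid.decidable (u v y : Fin m → Bool) (t : ℕ) : Decidable (Hybrid u v y t) := by
  unfold Hybrid; infer_instance

/-- What player `p` can check of the path edge switching coordinate `p`: the column `y` agrees
with both endpoints off coordinate `p` ("`w_i` and `w_{i+1}` differ only in one coordinate").
[cite: AdaEtAl2014, proof of Thm. 2 (PDF p. 7)] -/
def EdgeSeen (u v y : Fin m → Bool) (p : Fin m) : Prop :=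
  ∀ q : Fin m, q ≠ p → y q = if (q : ℕ) < p then u q else v q

/-- `EdgeSeen` is decidable (a finite conjunction of Boolean equalities). [folklore] -/
instance EdgeSeen.decidable (u v y : Fin m → Bool) (p : Fin m) : Decidable (EdgeSeen u v y p) := by
  unfold EdgeSeen; infer_instance

/-- The coordinates below `t` in which `v` and `u` differ (the path edges before `t`).
[cite: AdaEtAl2014, proof of Thm. 2 (PDF p. 6)] -/
def flips (u v : Fin m → Bool) (t : ℕ) : Finset (Fin m) :=
  univ.filter fun q => (q : ℕ) < t ∧ v q ≠ u q

/-- The `0`-th path vertex is `v` itself. [folklore] -/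
theorem hybrid_zero_iff (u v y : Fin m → Bool) : Hybrid u v y 0 ↔ y = v := by
  unfold Hybrid
  simp only [Nat.not_lt_zero, if_false]
  exact ⟨fun h => funext h, fun h q => by rw [h]⟩

/-- From `t ≥ m` on, the path vertex is `u`. [folklore] -/
theorem hybrid_iff_eq_of_le (u v y : Fin m → Bool) {t : ℕ} (h : m ≤ t) :
    Hybrid u v y t ↔ y = u := by
  unfold Hybrid
  constructor
  · intro hq
    funext q
    have := hq q
    rwa [if_pos (lt_of_lt_of_le q.2 h)] at this
  · rintro rfl q
    rw [if_pos (lt_of_lt_of_le q.2 h)]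

/-- From `t ≥ m` on, all differing coordinates have been switched. [folklore] -/
theorem flips_of_le (u v : Fin m → Bool) {t : ℕ} (h : m ≤ t) :
    flips u v t = univ.filter fun q => v q ≠ u q := by
  ext q
  simp [flips, lt_of_lt_of_le q.2 h]

/-- No coordinate is switched before `0`. [folklore] -/
theorem flips_zero (u v : Fin m → Bool) : flips u v 0 = ∅ := by
  ext q
  simp [flips]

/-- Partial sums of the alternating edge indicators telescope.
[cite: AdaEtAl2014, proof of Thm. 2, eqs. (1), (4) of the full version (ECCC TR11-155, p. 11)] -/
theorem cube_telescope_aux (u v y : Fin m → Bool) : ∀ t : ℕ,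
    ∑ p ∈ flips u v t, (-1 : ℤ) ^ (flips u v p).card * (if EdgeSeen u v y p then 1 else 0) =
      (if Hybrid u v y 0 then 1 else 0) -
        (-1) ^ (flips u v t).card * (if Hybrid u v y t then 1 else 0)
  | 0 => by simp [flips_zero]
  | t + 1 => by
      have IH := cube_telescope_aux u v y t
      by_cases ht : t < m
      · -- the new coordinate is `p₀ = t`
        have hval : ∀ q : Fin m, (q : ℕ) = t ↔ q = ⟨t, ht⟩ := fun q =>
          ⟨fun h => Fin.ext h, fun h => by rw [h]⟩
        by_cases hvu : v ⟨t, ht⟩ = u ⟨t, ht⟩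
        · -- degenerate step: nothing changes
          have hF : flips u v (t + 1) = flips u v t := by
            ext q
            simp only [flips, mem_filter, mem_univ, true_and]
            constructor
            · rintro ⟨hq, hne⟩
              refine ⟨?_, hne⟩
              rcases Nat.lt_succ_iff_lt_or_eq.1 hq with h | h
              · exact h
              · exact absurd ((hval q).1 h ▸ hvu) hne
            · rintro ⟨hq, hne⟩
              exact ⟨Nat.lt_succ_of_lt hq, hne⟩
          have hH : Hybrid u v y (t + 1) ↔ Hybrid u v y t := by
            unfold Hybrid
            refine forall_congr' fun q => ?_
            by_cases hq : (q : ℕ) = t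
            · have hq' := (hval q).1 hq
              rw [if_pos (by omega), if_neg (by omega), hq', hvu]
            · have : (q : ℕ) < t + 1 ↔ (q : ℕ) < t := by omega
              rw [show (if (q : ℕ) < t + 1 then u q else v q) = if (q : ℕ) < t then u q else v q
                from by simp only [this]]
          rw [hF, IH]
          simp only [hH]
        · -- a genuine edge at coordinate `t`
          have hnot : (⟨t, ht⟩ : Fin m) ∉ flips u v t := by simp [flips]
          have hF : flips u v (t + 1) = insert ⟨t, ht⟩ (flips u v t) := by
            ext q
            simp only [flips, mem_filter, mem_univ, true_and, mem_insert]
            constructor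
            · rintro ⟨hq, hne⟩
              rcases Nat.lt_succ_iff_lt_or_eq.1 hq with h | h
              · exact Or.inr ⟨h, hne⟩
              · exact Or.inl ((hval q).1 h)
            · rintro (h | ⟨hq, hne⟩)
              · rw [h]
                exact ⟨Nat.lt_succ_self t, hvu⟩
              · exact ⟨Nat.lt_succ_of_lt hq, hne⟩
          -- the key: the edge indicator is the sum of the two endpoint indicators
          have hE : EdgeSeen u v y ⟨t, ht⟩ ↔
              ∀ q : Fin m, q ≠ ⟨t, ht⟩ → y q = if (q : ℕ) < t then u q else v q := Iff.rfl
          have hHt : Hybrid u v y t ↔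
              (∀ q : Fin m, q ≠ ⟨t, ht⟩ → y q = if (q : ℕ) < t then u q else v q) ∧
                y ⟨t, ht⟩ = v ⟨t, ht⟩ := by
            unfold Hybrid
            constructor
            · intro h
              refine ⟨fun q _ => h q, ?_⟩
              have := h ⟨t, ht⟩
              rwa [if_neg (lt_irrefl t)] at this
            · rintro ⟨h1, h2⟩ q
              by_cases hq : q = ⟨t, ht⟩
              · rw [hq, if_neg (lt_irrefl t), h2]
              · exact h1 q hq
          have hHt1 : Hybrid u v y (t + 1) ↔
              (∀ q : Fin m, q ≠ ⟨t, ht⟩ → y q = if (q : ℕ) < t then u q else v q) ∧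
                y ⟨t, ht⟩ = u ⟨t, ht⟩ := by
            unfold Hybrid
            constructor
            · intro h
              refine ⟨fun q hq => ?_, ?_⟩
              · have hqt : (q : ℕ) ≠ t := fun h' => hq ((hval q).1 h')
                have := h q
                have hiff : (q : ℕ) < t + 1 ↔ (q : ℕ) < t := by omega
                simp only [hiff] at this
                exact this
              · have := h ⟨t, ht⟩
                rwa [if_pos (Nat.lt_succ_self t)] at this
            · rintro ⟨h1, h2⟩ q
              by_cases hq : q = ⟨t, ht⟩
              · rw [hq, if_pos (Nat.lt_succ_self t), h2]
              · have hqt : (q : ℕ) ≠ t := fun h' => hq ((hval q).1 h')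
                have hiff : (q : ℕ) < t + 1 ↔ (q : ℕ) < t := by omega
                simp only [hiff]
                exact h1 q hq
          have key : (if EdgeSeen u v y ⟨t, ht⟩ then (1 : ℤ) else 0) =
              (if Hybrid u v y t then 1 else 0) + (if Hybrid u v y (t + 1) then 1 else 0) := by
            by_cases hEd : EdgeSeen u v y ⟨t, ht⟩
            · rw [if_pos hEd]
              have hA := hE.1 hEd
              by_cases hy : y ⟨t, ht⟩ = v ⟨t, ht⟩
              · have hy' : y ⟨t, ht⟩ ≠ u ⟨t, ht⟩ := fun h => hvu (hy.symm.trans h)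
                rw [if_pos (hHt.2 ⟨hA, hy⟩), if_neg (fun h => hy' (hHt1.1 h).2)]
                norm_num
              · have hy' : y ⟨t, ht⟩ = u ⟨t, ht⟩ := by
                  revert hy hvu
                  cases y ⟨t, ht⟩ <;> cases v ⟨t, ht⟩ <;> cases u ⟨t, ht⟩ <;> decide
                rw [if_neg (fun h => hy (hHt.1 h).2), if_pos (hHt1.2 ⟨hA, hy'⟩)]
                norm_num
            · rw [if_neg hEd, if_neg (fun h => hEd (hE.2 (hHt.1 h).1)),
                if_neg (fun h => hEd (hE.2 (hHt1.1 h).1))]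
              norm_num
          rw [hF, sum_insert hnot, IH, card_insert_of_notMem hnot, pow_succ]
          have hp : (flips u v ((⟨t, ht⟩ : Fin m) : ℕ)) = flips u v t := rfl
          rw [hp, key]
          ring
      · -- `t ≥ m`: both the edge set and the hybrid condition are stable
        have ht : m ≤ t := not_lt.1 ht
        have hF : flips u v (t + 1) = flips u v t := by
          rw [flips_of_le u v ht, flips_of_le u v (Nat.le_succ_of_le ht)]
        have hH : Hybrid u v y (t + 1) ↔ Hybrid u v y t := by
          rw [hybrid_iff_eq_of_le u v y ht, hybrid_iff_eq_of_le u v y (Nat.le_succ_of_le ht)]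
        rw [hF, IH]
        simp only [hH]

/-- **The cube telescoping identity** (Grolmusz; ACFN eqs. (1), (4), (6)): for vertices
`u, v` of the `m`-cube and a column `y`, the alternating sum over the edges of the canonical
path from `v` to `u` of the indicators "`y` is one of the two endpoints of the edge" — the
edge at coordinate `p` being checkable by player `p` — equals `[y = v] - (-1)^{d(u,v)} [y = u]`.
[cite: AdaEtAl2014, proof of Thm. 2 (PDF pp. 6–7; full version ECCC TR11-155, eqs. (1), (4), (6))] -/
theorem cube_telescope (u v y : Fin m → Bool) :
    ∑ p ∈ univ.filter (fun p => v p ≠ u p),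
        (-1 : ℤ) ^ (flips u v p).card * (if EdgeSeen u v y p then 1 else 0) =
      (if y = v then 1 else 0) - (-1) ^ (univ.filter fun q => v q ≠ u q).card * (if y = u then 1 else 0) := by
  have h := cube_telescope_aux u v y m
  rw [flips_of_le u v le_rfl] at h
  rw [h]
  simp only [hybrid_zero_iff, hybrid_iff_eq_of_le u v y le_rfl]

end Cube

/-! ### Babai–Gál–Kimmel–Lokam: the column-weight statistics (ACFN Lemma 3.1), sharp form -/

section BGKL

variable {ℓ : ℕ}

/-- The Hamming weight of a column over the `ℓ` speaking rows. [cite: AdaEtAl2014, Lemma 2 (PDF p. 6)] -/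
def wt (y : Fin ℓ → Bool) : ℕ := (univ.filter fun q => y q = true).card

/-- The weight of a column with row `p` hidden — what player `p` sees of it.
[cite: AdaEtAl2014, Lemma 2 (PDF p. 6)] -/
def wtErase (p : Fin ℓ) (y : Fin ℓ → Bool) : ℕ := ((univ.erase p).filter fun q => y q = true).card

/-- The weight is the hidden-row weight plus the hidden bit. [folklore] -/
theorem wt_eq_wtErase_add (p : Fin ℓ) (y : Fin ℓ → Bool) :
    wt y = wtErase p y + (y p).toNat := by
  unfold wt wtErase
  rw [Finset.filter_erase]
  rcases Bool.eq_false_or_eq_true (y p) with h | h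
  · have hmem : p ∈ univ.filter fun q => y q = true := by simp [h]
    rw [h, Bool.toNat_true, Finset.card_erase_of_mem hmem]
    have := Finset.card_pos.2 ⟨p, hmem⟩
    omega
  · have hmem : p ∉ univ.filter fun q => y q = true := by simp [h]
    rw [h, Bool.toNat_false, Finset.erase_eq_of_notMem hmem, add_zero]

/-- The hidden-row weight depends on the visible rows only. [folklore] -/
theorem wtErase_congr (p : Fin ℓ) {y y' : Fin ℓ → Bool} (h : ∀ q, q ≠ p → y q = y' q) :
    wtErase p y = wtErase p y' := by
  unfold wtErase
  congr 1
  refine Finset.filter_congr fun q hq => ?_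
  rw [h q (Finset.mem_erase.1 hq).1]

/-- A column over `ℓ` rows has weight at most `ℓ`. [folklore] -/
theorem wt_le (y : Fin ℓ → Bool) : wt y ≤ ℓ :=
  (card_filter_le _ _).trans (by simp)

/-- With a row hidden the weight is below `ℓ`. [folklore] -/
theorem wtErase_lt (p : Fin ℓ) (y : Fin ℓ → Bool) : wtErase p y < ℓ := by
  unfold wtErase
  calc ((univ.erase p).filter fun q => y q = true).card ≤ (univ.erase p).card := card_filter_le _ _
    _ < ℓ := by
        rw [Finset.card_erase_of_mem (mem_univ p), card_univ, Fintype.card_fin]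
        have := p.2
        omega

/-- Weight `0` means the all-zero column. [folklore] -/
theorem wt_eq_zero_iff (y : Fin ℓ → Bool) : wt y = 0 ↔ y = fun _ => false := by
  unfold wt
  rw [Finset.card_eq_zero, Finset.filter_eq_empty_iff]
  constructor
  · intro h
    funext q
    simpa using h (mem_univ q)
  · rintro rfl
    simp

/-- The number of zero-entries of a column is `ℓ - wt`. [folklore] -/
theorem card_filter_eq_false (y : Fin ℓ → Bool) :
    (univ.filter fun p => y p = false).card = ℓ - wt y := by
  have h := Finset.card_filter_add_card_filter_not (s := (univ : Finset (Fin ℓ)))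
    (fun p => y p = true)
  simp only [card_univ, Fintype.card_fin] at h
  have h2 : (univ.filter fun p => ¬ y p = true) = univ.filter fun p => y p = false := by
    refine Finset.filter_congr fun p _ => ?_
    simp
  rw [h2] at h
  unfold wt
  omega

/-- **One column, all players** (the double count behind Lemma 3.1): the number of players to
whom a column of weight `s` shows weight `w` is `ℓ - w` if `s = w` (the players holding a `0`)
plus `w + 1` if `s = w + 1` (the players holding a `1`).
[cite: AdaEtAl2014, Lemma 2 (PDF p. 6); BabaiGalKimmelLokam2003, Lemma 6.10] -/
theorem card_filter_wtErase_eq (y : Fin ℓ → Bool) (w : ℕ) :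
    (univ.filter fun p => wtErase p y = w).card =
      (if wt y = w then ℓ - w else 0) + (if wt y = w + 1 then w + 1 else 0) := by
  have hiff : ∀ p, wtErase p y = w ↔ wt y = w + (y p).toNat := by
    intro p
    have := wt_eq_wtErase_add p y
    omega
  by_cases h1 : wt y = w
  · rw [if_pos h1, if_neg (by omega)]
    have : (univ.filter fun p => wtErase p y = w) = univ.filter fun p => y p = false := by
      ext p
      simp only [mem_filter, mem_univ, true_and, hiff]
      rcases Bool.eq_false_or_eq_true (y p) with hp | hp
      · rw [hp, Bool.toNat_true]
        simp only [Bool.true_eq_false, iff_false]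
        omega
      · rw [hp, Bool.toNat_false]
        simp only [add_zero, iff_true]
        exact h1
    rw [this, add_zero, card_filter_eq_false, h1]
  · rw [if_neg h1, zero_add]
    by_cases h2 : wt y = w + 1
    · rw [if_pos h2]
      have : (univ.filter fun p => wtErase p y = w) = univ.filter fun p => y p = true := by
        ext p
        simp only [mem_filter, mem_univ, true_and, hiff]
        rcases Bool.eq_false_or_eq_true (y p) with hp | hp
        · rw [hp, Bool.toNat_true]
          simp only [iff_true]
          exact h2
        · rw [hp, Bool.toNat_false]
          simp only [add_zero, Bool.false_eq_true, iff_false]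
          exact h1
      rw [this]
      exact h2
    · rw [if_neg h2]
      rw [Finset.card_eq_zero, Finset.filter_eq_empty_iff]
      intro p _
      rw [hiff]
      rcases Bool.eq_false_or_eq_true (y p) with hp | hp
      · rw [hp, Bool.toNat_true]
        exact h2
      · rw [hp, Bool.toNat_false, add_zero]
        exact h1

/-- **The player-sum identity of Lemma 3.1 (weighted columns).** Summing over the players `p`
the total weight of the columns that show Hamming weight `w` to `p` gives
`(ℓ - w) · N_w + (w + 1) · N_{w+1}`, where `N_s` is the total weight of the columns of Hamming
weight `s` (column `j` carrying a multiplicity `c j`, as in ACFN's duplicated matrix `X'`).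
[cite: AdaEtAl2014, Lemma 2 and proof of Thm. 2(c) (PDF pp. 6–7); BabaiGalKimmelLokam2003, Lemma 6.10] -/
theorem bgkl_player_sum {J : Type} [Fintype J] (col : J → Fin ℓ → Bool) (c : J → ℕ) (w : ℕ) :
    ∑ p : Fin ℓ, ∑ j ∈ univ.filter (fun j => wtErase p (col j) = w), c j =
      (ℓ - w) * ∑ j ∈ univ.filter (fun j => wt (col j) = w), c j +
        (w + 1) * ∑ j ∈ univ.filter (fun j => wt (col j) = w + 1), c j := by
  have h1 : ∀ p : Fin ℓ, ∑ j ∈ univ.filter (fun j => wtErase p (col j) = w), c j =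
      ∑ j, if wtErase p (col j) = w then c j else 0 := fun p => Finset.sum_filter _ _
  simp_rw [h1]
  rw [Finset.sum_comm]
  have h2 : ∀ j : J, ∑ p : Fin ℓ, (if wtErase p (col j) = w then c j else 0) =
      (univ.filter fun p => wtErase p (col j) = w).card * c j := by
    intro j
    rw [Finset.sum_ite, Finset.sum_const_zero, add_zero, Finset.sum_const, smul_eq_mul]
  simp_rw [h2, card_filter_wtErase_eq, add_mul, Finset.sum_add_distrib]
  have e1 : ∑ j, (if wt (col j) = w then ℓ - w else 0) * c j =
      (ℓ - w) * ∑ j ∈ univ.filter (fun j => wt (col j) = w), c j := by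
    rw [Finset.mul_sum, Finset.sum_filter]
    refine Finset.sum_congr rfl fun j _ => ?_
    split <;> simp
  have e2 : ∑ j, (if wt (col j) = w + 1 then w + 1 else 0) * c j =
      (w + 1) * ∑ j ∈ univ.filter (fun j => wt (col j) = w + 1), c j := by
    rw [Finset.mul_sum, Finset.sum_filter]
    refine Finset.sum_congr rfl fun j _ => ?_
    split <;> simp
  rw [e1, e2]
  ring

/-- **Lemma 3.1 / BGKL Lemma 6.10, sharp uniqueness form.** For `ℓ ≥ 1` rows: if two weighted
column families, each of total weight `< 2^{ℓ-1}` (i.e. "`ℓ > 1 + log n`"), show the same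
statistics to every player — for every `p` and `w`, the same total weight of columns of
`p`-hidden weight `w` — then they have the same total weight of columns of each Hamming weight
`w`; in particular the same (weighted) number of all-zero columns. Proof: the differences
`δ_w` of the two weight histograms satisfy `(w+1) δ_{w+1} = -(ℓ-w) δ_w`, hence
`δ_w = (-1)^w C(ℓ,w) δ_0` and `|δ_0| 2^ℓ = Σ_w |δ_w| < 2^ℓ`.
[cite: AdaEtAl2014, Lemma 2 (PDF p. 6); BabaiGalKimmelLokam2003, Lemma 6.10] -/
theorem bgkl_unique {J J' : Type} [Fintype J] [Fintype J'] (hℓ : 1 ≤ ℓ)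
    (col : J → Fin ℓ → Bool) (c : J → ℕ) (col' : J' → Fin ℓ → Bool) (c' : J' → ℕ)
    (hc : ∑ j, c j < 2 ^ (ℓ - 1)) (hc' : ∑ j, c' j < 2 ^ (ℓ - 1))
    (hstat : ∀ (p : Fin ℓ) (w : ℕ), ∑ j ∈ univ.filter (fun j => wtErase p (col j) = w), c j =
      ∑ j ∈ univ.filter (fun j => wtErase p (col' j) = w), c' j) (w : ℕ) :
    ∑ j ∈ univ.filter (fun j => wt (col j) = w), c j =
      ∑ j ∈ univ.filter (fun j => wt (col' j) = w), c' j := by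
  set M : ℕ → ℕ := fun w => ∑ j ∈ univ.filter (fun j => wt (col j) = w), c j with hM
  set M' : ℕ → ℕ := fun w => ∑ j ∈ univ.filter (fun j => wt (col' j) = w), c' j with hM'
  have hrel : ∀ w, (ℓ - w) * M w + (w + 1) * M (w + 1) = (ℓ - w) * M' w + (w + 1) * M' (w + 1) := by
    intro w
    simp only [hM, hM']
    rw [← bgkl_player_sum col c w, ← bgkl_player_sum col' c' w]
    exact Finset.sum_congr rfl fun p _ => hstat p w
  set δ : ℕ → ℤ := fun w => (M w : ℤ) - M' w with hδ
  have hδrel : ∀ w : ℕ, ((w : ℤ) + 1) * δ (w + 1) = -((ℓ - w : ℕ) : ℤ) * δ w := by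
    intro w
    have h' := congrArg (Nat.cast : ℕ → ℤ) (hrel w)
    push_cast at h'
    simp only [hδ]
    linear_combination h'
  have hclosed : ∀ w : ℕ, δ w = (-1) ^ w * (Nat.choose ℓ w : ℤ) * δ 0 := by
    intro w
    induction w with
    | zero => simp
    | succ w ih =>
      have h1 := hδrel w
      rw [ih] at h1
      have hch : ((Nat.choose ℓ (w + 1) * (w + 1) : ℕ) : ℤ) =
          ((Nat.choose ℓ w * (ℓ - w) : ℕ) : ℤ) := by
        rw [Nat.choose_succ_right_eq]
      push_cast at hch
      have hw : ((w : ℤ) + 1) ≠ 0 := by positivity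
      apply mul_left_cancel₀ hw
      rw [h1, pow_succ]
      linear_combination (-1) ^ w * δ 0 * hch
  have hsum_abs : ∑ w ∈ range (ℓ + 1), |δ w| = |δ 0| * 2 ^ ℓ := by
    have habs : ∀ w : ℕ, |δ w| = |δ 0| * (Nat.choose ℓ w : ℤ) := by
      intro w
      rw [hclosed w, abs_mul, abs_mul, abs_pow, abs_neg, abs_one, one_pow, one_mul,
        Nat.abs_cast]
      ring
    rw [Finset.sum_congr rfl fun w _ => habs w, ← Finset.mul_sum]
    congr 1
    exact_mod_cast Nat.sum_range_choose ℓ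
  have hMsum : ∑ w ∈ range (ℓ + 1), M w = ∑ j, c j := by
    simp only [hM]
    exact Finset.sum_fiberwise_of_maps_to
      (fun j _ => Finset.mem_range.2 (Nat.lt_succ_of_le (wt_le (col j)))) _
  have hM'sum : ∑ w ∈ range (ℓ + 1), M' w = ∑ j, c' j := by
    simp only [hM']
    exact Finset.sum_fiberwise_of_maps_to
      (fun j _ => Finset.mem_range.2 (Nat.lt_succ_of_le (wt_le (col' j)))) _
  have hbound : ∑ w ∈ range (ℓ + 1), |δ w| ≤ ((∑ j, c j : ℕ) : ℤ) + ((∑ j, c' j : ℕ) : ℤ) := by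
    calc ∑ w ∈ range (ℓ + 1), |δ w| ≤ ∑ w ∈ range (ℓ + 1), ((M w : ℤ) + M' w) := by
          refine Finset.sum_le_sum fun w _ => ?_
          simp only [hδ]
          exact abs_sub_le_iff.2 ⟨by linarith [Int.natCast_nonneg (M' w)],
            by linarith [Int.natCast_nonneg (M w)]⟩
      _ = ((∑ j, c j : ℕ) : ℤ) + ((∑ j, c' j : ℕ) : ℤ) := by
          rw [Finset.sum_add_distrib, ← hMsum, ← hM'sum]
          push_cast
          rfl
  have h2 : (2 : ℤ) ^ (ℓ - 1) + 2 ^ (ℓ - 1) = 2 ^ ℓ := by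
    obtain ⟨l, rfl⟩ : ∃ l, ℓ = l + 1 := ⟨ℓ - 1, by omega⟩
    rw [Nat.add_sub_cancel, pow_succ]
    ring
  have hδ0 : δ 0 = 0 := by
    by_contra hne
    have h1 : 1 ≤ |δ 0| := Int.one_le_abs hne
    have hlt : |δ 0| * 2 ^ ℓ < 2 ^ ℓ := by
      calc |δ 0| * 2 ^ ℓ = ∑ w ∈ range (ℓ + 1), |δ w| := hsum_abs.symm
        _ ≤ ((∑ j, c j : ℕ) : ℤ) + ((∑ j, c' j : ℕ) : ℤ) := hbound
        _ < 2 ^ (ℓ - 1) + 2 ^ (ℓ - 1) := by exact_mod_cast add_lt_add hc hc'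
        _ = 2 ^ ℓ := h2
    nlinarith [pow_pos (show (0 : ℤ) < 2 by norm_num) ℓ]
  have hδw : δ w = 0 := by rw [hclosed w, hδ0, mul_zero]
  simp only [hδ, sub_eq_zero] at hδw
  exact_mod_cast hδw

end BGKL

/-! ### Step 2 of the protocol: each player's part of the count -/

section Parts

variable {K : ℕ}

/-- The coefficient of `1_j(u)` collected from the telescoping sums over the support `S`:
`Σ_{v ∈ S} (-1)^{d(u,v)}` (ACFN's `c_j`, before reduction mod `n + 1`).
[cite: AdaEtAl2014, proof of Thm. 2(c) (PDF p. 7; full version ECCC TR11-155, p. 12)] -/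
def topCoeff (u : Fin K → Bool) (S : (Fin K → Bool) → Bool) : ℤ :=
  ∑ v ∈ univ.filter (fun v => S v = true), (-1 : ℤ) ^ (univ.filter fun q => v q ≠ u q).card

/-- **Player `p`'s part** for one column `y` with support `S`: the signed sum, over the support
vectors `v` whose path to `u` uses coordinate `p`, of the edge indicators she can check.
[cite: AdaEtAl2014, proof of Thm. 2 (PDF p. 7: "each player announces her part of the sum")] -/
def edgePart (u : Fin K → Bool) (S : (Fin K → Bool) → Bool) (p : Fin K) (y : Fin K → Bool) : ℤ :=
  ∑ v ∈ univ.filter (fun v => S v = true ∧ v p ≠ u p),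
    (-1 : ℤ) ^ (flips u v p).card * (if EdgeSeen u v y p then 1 else 0)

/-- Player `p`'s part does not depend on coordinate `p` of the column. [cite: AdaEtAl2014, proof of Thm. 2 (PDF p. 7)] -/
theorem edgePart_congr (u : Fin K → Bool) (S : (Fin K → Bool) → Bool) (p : Fin K)
    {y y' : Fin K → Bool} (h : ∀ q, q ≠ p → y q = y' q) : edgePart u S p y = edgePart u S p y' := by
  unfold edgePart
  refine Finset.sum_congr rfl fun v _ => ?_
  have hiff : EdgeSeen u v y p ↔ EdgeSeen u v y' p := by
    unfold EdgeSeen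
    refine forall_congr' fun q => imp_congr_right fun hq => ?_
    rw [h q hq]
  rw [if_congr hiff rfl rfl]

/-- **Summing the parts over the players** recovers, for a column `y`, the indicator of the
support minus the correction `ĉ · [y = u]` (which vanishes when `u` is missing from the
column). [cite: AdaEtAl2014, proof of Thm. 2, eqs. (2)–(6) of the full version (ECCC TR11-155, pp. 11–12)] -/
theorem sum_edgePart (u : Fin K → Bool) (S : (Fin K → Bool) → Bool) (y : Fin K → Bool) :
    ∑ p, edgePart u S p y =
      (if S y = true then 1 else 0) - topCoeff u S * (if y = u then 1 else 0) := by
  unfold edgePart topCoeff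
  have h1 : ∀ p : Fin K,
      ∑ v ∈ univ.filter (fun v => S v = true ∧ v p ≠ u p),
          (-1 : ℤ) ^ (flips u v p).card * (if EdgeSeen u v y p then 1 else 0) =
        ∑ v ∈ univ.filter (fun v => S v = true),
          if v p ≠ u p then (-1 : ℤ) ^ (flips u v p).card * (if EdgeSeen u v y p then 1 else 0)
          else 0 := by
    intro p
    rw [← Finset.sum_filter, Finset.filter_filter]
  simp_rw [h1]
  rw [Finset.sum_comm]
  have h2 : ∀ v : Fin K → Bool,
      ∑ p : Fin K, (if v p ≠ u p then
          (-1 : ℤ) ^ (flips u v p).card * (if EdgeSeen u v y p then 1 else 0) else 0) =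
        (if y = v then 1 else 0) -
          (-1) ^ (univ.filter fun q => v q ≠ u q).card * (if y = u then 1 else 0) := by
    intro v
    rw [← Finset.sum_filter]
    exact cube_telescope u v y
  simp_rw [h2]
  rw [Finset.sum_sub_distrib, Finset.sum_ite_eq, ← Finset.sum_mul]
  simp

end Parts

/-! ### Part (a): the deterministic protocol for `f ∘ g⃗` (Grolmusz's protocol extended) -/

section PartA

variable {k K n : ℕ}

/-- Column `j` of the input matrix. [cite: AdaEtAl2014, §2 (PDF p. 5)] -/
def col (X : NOFInput k n) (j : Fin n) : Fin k → Bool := fun i => X i j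

/-- Changing row `i` does not change the other entries of a column. [folklore] -/
theorem col_update_of_ne {X : NOFInput k n} {i q : Fin k} (h : q ≠ i) (r : Fin n → Bool)
    (j : Fin n) : col (Function.update X i r) j q = col X j q := by
  simp [col, Function.update_of_ne h]

/-- Column `j` without its row-`0` entry: what player `0` sees of it. [cite: AdaEtAl2014, proof of Thm. 2(a) (PDF p. 6)] -/
def tailCol (X : NOFInput (K + 2) n) (j : Fin n) : Fin (K + 1) → Bool := fun q => X q.succ j

/-- A column is its row-`0` entry followed by its tail. [folklore] -/
theorem col_eq_cons (X : NOFInput (K + 2) n) (j : Fin n) :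
    col X j = Fin.cons (X 0 j) (tailCol X j) :=
  (Fin.cons_self_tail (col X j)).symm

/-- The tails do not depend on row `0` (player `0` sees them). [folklore] -/
theorem tailCol_update_zero (X : NOFInput (K + 2) n) (r : Fin n → Bool) :
    tailCol (Function.update X 0 r) = tailCol X := by
  funext j q
  simp [tailCol]

/-- How often the tail `s` occurs among the columns. [cite: AdaEtAl2014, proof of Thm. 2(a) (PDF p. 6)] -/
def tailCount (X : NOFInput (K + 2) n) (s : Fin (K + 1) → Bool) : ℕ :=
  (univ.filter fun j => tailCol X j = s).card

/-- **The least frequent tail** (Grolmusz's first step: "the string that appears the least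
number of times as a column ... appears at most `n/2^{k-2}` times"; here over the `k - 1`
rows seen by player `0`). [cite: AdaEtAl2014, proof of Thm. 2(a) (PDF p. 6; full version p. 10)] -/
def rareTail (X : NOFInput (K + 2) n) : Fin (K + 1) → Bool := Function.argmin (tailCount X)

/-- Averaging: the least frequent of the `2^{K+1}` tails occurs at most `n / 2^{K+1}` times.
[cite: AdaEtAl2014, proof of Thm. 2(a) (full version ECCC TR11-155, p. 10)] -/
theorem tailCount_rareTail_le (X : NOFInput (K + 2) n) :
    tailCount X (rareTail X) ≤ n / 2 ^ (K + 1) := by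
  by_contra h
  have hall : ∀ s, n / 2 ^ (K + 1) + 1 ≤ tailCount X s := fun s =>
    (Nat.succ_le_of_lt (not_le.1 h)).trans (Function.argmin_le (tailCount X) s)
  have hsum : ∑ s : Fin (K + 1) → Bool, tailCount X s = n := by
    unfold tailCount
    rw [← Finset.card_eq_sum_card_fiberwise (f := tailCol X) (s := univ) (t := univ)
      fun _ _ => mem_univ _]
    simp
  have h1 := Finset.card_nsmul_le_sum (univ : Finset (Fin (K + 1) → Bool)) (tailCount X)
    (n / 2 ^ (K + 1) + 1) fun s _ => hall s
  rw [hsum, card_univ, smul_eq_mul] at h1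
  have hcard : Fintype.card (Fin (K + 1) → Bool) = 2 ^ (K + 1) := by simp
  rw [hcard] at h1
  have h2 := Nat.lt_mul_div_succ n (show 0 < 2 ^ (K + 1) by positivity)
  omega

/-- The columns carrying the least frequent tail (the columns where `u` might sit).
[cite: AdaEtAl2014, proof of Thm. 2(a) (PDF p. 6)] -/
def rareSet (X : NOFInput (K + 2) n) : Finset (Fin n) :=
  univ.filter fun j => tailCol X j = rareTail X

/-- At most `⌊n/2^{K+1}⌋` columns carry the least frequent tail.
[cite: AdaEtAl2014, proof of Thm. 2(a) (full version ECCC TR11-155, p. 10)] -/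
theorem card_rareSet_le (X : NOFInput (K + 2) n) : (rareSet X).card ≤ n / 2 ^ (K + 1) :=
  tailCount_rareTail_le X

/-- Writing a set of at most `L₀` column indices as a list of `L₀` optional indices
(`⌈log₂(n+1)⌉` bits each). [folklore] -/
def encodeSet (L₀ : ℕ) (J : Finset (Fin n)) : Fin L₀ → Option (Fin n) := fun m =>
  if h : (m : ℕ) < J.card then some (J.orderEmbOfFin rfl ⟨m, h⟩) else none

/-- Reading the set back from the list. [folklore] -/
def decodeSet {L₀ : ℕ} (lst : Fin L₀ → Option (Fin n)) : Finset (Fin n) :=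
  univ.filter fun j => ∃ m, lst m = some j

/-- Decoding the list of a small enough set gives the set back. [folklore] -/
theorem decodeSet_encodeSet {L₀ : ℕ} (J : Finset (Fin n)) (hJ : J.card ≤ L₀) :
    decodeSet (encodeSet L₀ J) = J := by
  ext j
  simp only [decodeSet, mem_filter, mem_univ, true_and]
  constructor
  · rintro ⟨m, hm⟩
    unfold encodeSet at hm
    split_ifs at hm with h
    rw [← Option.some.inj hm]
    exact Finset.orderEmbOfFin_mem J rfl _
  · intro hj
    have : j ∈ Set.range (J.orderEmbOfFin rfl) := by
      rw [Finset.range_orderEmbOfFin]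
      exact hj
    obtain ⟨i, hi⟩ := this
    refine ⟨⟨i, lt_of_lt_of_le i.2 hJ⟩, ?_⟩
    unfold encodeSet
    rw [dif_pos i.2, ← hi]

/-- **Player `0`'s announcement** (step 1): the least frequent tail `u'` and the list of the
columns carrying it — `(k-1) + ⌈log₂(n+1)⌉ · ⌊n/2^{k-1}⌋` bits.
[cite: AdaEtAl2014, proof of Thm. 2(a) (PDF p. 6; full version pp. 10–11)] -/
def annA (X : NOFInput (K + 2) n) :
    (Fin (K + 1) → Bool) × (Fin (n / 2 ^ (K + 1)) → Option (Fin n)) :=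
  (rareTail X, encodeSet _ (rareSet X))

/-- Player `0`'s announcement does not depend on row `0`. [cite: AdaEtAl2014, proof of Thm. 2(a) (PDF p. 6)] -/
theorem annA_update_zero (X : NOFInput (K + 2) n) (r : Fin n → Bool) :
    annA (Function.update X 0 r) = annA X := by
  unfold annA rareSet rareTail tailCount
  rw [tailCol_update_zero]

/-- Player `0`'s announcement takes `(k-1) + ⌈log₂(n+1)⌉ · ⌊n/2^{k-1}⌋` bits.
[cite: AdaEtAl2014, proof of Thm. 2(a) (PDF p. 6: "the cost is `O(k + n/2^k · log n)` bits")] -/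
theorem card_annType_le (K n : ℕ) :
    Fintype.card ((Fin (K + 1) → Bool) × (Fin (n / 2 ^ (K + 1)) → Option (Fin n))) ≤
      2 ^ ((K + 1) + Nat.size n * (n / 2 ^ (K + 1))) := by
  simp only [Fintype.card_prod, Fintype.card_fun, Fintype.card_bool, Fintype.card_fin,
    Fintype.card_option]
  rw [pow_add (2 : ℕ) (K + 1) (Nat.size n * (n / 2 ^ (K + 1))),
    pow_mul (2 : ℕ) (Nat.size n) (n / 2 ^ (K + 1))]
  exact Nat.mul_le_mul_left _ (Nat.pow_le_pow_left (Nat.lt_size_self n) _)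

/-- **Player `p`'s number** (step 2, as an integer before reduction mod `n + 1`): her parts of
the telescoping sums for the columns off the list (with `u = 0·u'`), plus — for player `1`,
who sees row `0` — the count of good listed columns.
[cite: AdaEtAl2014, proof of Thm. 2(a) (PDF pp. 6–7; full version p. 11)] -/
def msgAInt (g : Fin n → (Fin (K + 2) → Bool) → Bool)
    (a : (Fin (K + 1) → Bool) × (Fin (n / 2 ^ (K + 1)) → Option (Fin n)))
    (p : Fin (K + 2)) (X : NOFInput (K + 2) n) : ℤ :=
  (∑ j ∈ (decodeSet a.2)ᶜ, edgePart (Fin.cons false a.1) (g j) p (col X j)) +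
    if p = 1 then ∑ j ∈ decodeSet a.2, (if g j (Fin.cons (X 0 j) a.1) = true then (1 : ℤ) else 0)
    else 0

/-- Player `p`'s number, reduced mod `n + 1` ("it suffices for players to send their part of
the sum modulo `n + 1`"). [cite: AdaEtAl2014, proof of Thm. 2(a) (PDF p. 7)] -/
def msgA (g : Fin n → (Fin (K + 2) → Bool) → Bool)
    (a : (Fin (K + 1) → Bool) × (Fin (n / 2 ^ (K + 1)) → Option (Fin n)))
    (p : Fin (K + 2)) (X : NOFInput (K + 2) n) : ℕ :=
  Int.toNat (msgAInt g a p X % ((n + 1 : ℕ) : ℤ))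

/-- Player `p`'s number is below `n + 1`. [cite: AdaEtAl2014, proof of Thm. 2(a) (PDF p. 7)] -/
theorem msgA_lt (g : Fin n → (Fin (K + 2) → Bool) → Bool)
    (a : (Fin (K + 1) → Bool) × (Fin (n / 2 ^ (K + 1)) → Option (Fin n)))
    (p : Fin (K + 2)) (X : NOFInput (K + 2) n) : msgA g a p X < n + 1 := by
  unfold msgA
  have h0 : (0 : ℤ) < ((n + 1 : ℕ) : ℤ) := by positivity
  have h1 := Int.emod_nonneg (msgAInt g a p X) h0.ne'
  have h2 := Int.emod_lt_of_pos (msgAInt g a p X) h0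
  omega

/-- Player `p`'s integer does not depend on row `p`. [cite: AdaEtAl2014, proof of Thm. 2(a) (PDF p. 7)] -/
theorem msgAInt_indep (g : Fin n → (Fin (K + 2) → Bool) → Bool)
    (a : (Fin (K + 1) → Bool) × (Fin (n / 2 ^ (K + 1)) → Option (Fin n))) (p : Fin (K + 2)) :
    IndepOfRow p (msgAInt g a p) := by
  intro X r
  unfold msgAInt
  congr 1
  · refine Finset.sum_congr rfl fun j _ => edgePart_congr _ _ _ fun q hq => ?_
    exact col_update_of_ne hq r j
  · by_cases hp : p = 1
    · subst hp
      rw [if_pos rfl, if_pos rfl]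
      refine Finset.sum_congr rfl fun j _ => ?_
      rw [Function.update_of_ne Fin.zero_ne_one]
    · rw [if_neg hp, if_neg hp]

/-- Player `p`'s number does not depend on row `p`. [cite: AdaEtAl2014, proof of Thm. 2(a) (PDF p. 7)] -/
theorem msgA_indep (g : Fin n → (Fin (K + 2) → Bool) → Bool)
    (a : (Fin (K + 1) → Bool) × (Fin (n / 2 ^ (K + 1)) → Option (Fin n))) (p : Fin (K + 2)) :
    IndepOfRow p (msgA g a p) := fun X r => by
  unfold msgA
  rw [msgAInt_indep g a p X r]

/-- **Correctness of step 2**: when the announced list is exactly the set of columns with tail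
`u'`, the players' integers sum to the number of columns `j` with `g_j(column j) = 1` — off
the list by the telescoping identity (`u = 0·u'` is missing there), on the list by player `1`'s
direct count. [cite: AdaEtAl2014, proof of Thm. 2(a) (PDF pp. 6–7; full version p. 11)] -/
theorem sum_msgAInt (g : Fin n → (Fin (K + 2) → Bool) → Bool) (X : NOFInput (K + 2) n)
    (a : (Fin (K + 1) → Bool) × (Fin (n / 2 ^ (K + 1)) → Option (Fin n)))
    (hT : decodeSet a.2 = univ.filter fun j => tailCol X j = a.1) :
    ∑ p, msgAInt g a p X = ∑ j, (if g j (col X j) = true then (1 : ℤ) else 0) := by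
  unfold msgAInt
  rw [Finset.sum_add_distrib, Finset.sum_comm, Finset.sum_ite_eq']
  simp only [mem_univ, if_true]
  have hmemT : ∀ j, j ∈ decodeSet a.2 ↔ tailCol X j = a.1 := by
    intro j
    rw [hT]
    simp
  have h1 : ∀ j ∈ (decodeSet a.2)ᶜ, ∑ p, edgePart (Fin.cons false a.1) (g j) p (col X j) =
      if g j (col X j) = true then 1 else 0 := by
    intro j hj
    rw [sum_edgePart]
    have hne : col X j ≠ Fin.cons false a.1 := by
      intro h
      have hj' := Finset.mem_compl.1 hj
      rw [hmemT] at hj'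
      apply hj'
      have := congrArg Fin.tail h
      rw [Fin.tail_cons] at this
      exact this
    rw [if_neg hne, mul_zero, sub_zero]
  have h2 : ∀ j ∈ decodeSet a.2, (if g j (Fin.cons (X 0 j) a.1) = true then (1 : ℤ) else 0) =
      if g j (col X j) = true then 1 else 0 := by
    intro j hj
    rw [hmemT] at hj
    rw [col_eq_cons X j, hj]
  rw [Finset.sum_congr rfl h1, Finset.sum_congr rfl h2, Finset.sum_compl_add_sum]

/-- Reduction mod `m` followed by `toNat` is the identity in `ZMod m`. [folklore] -/
theorem natCast_toNat_emod (x : ℤ) (m : ℕ) [NeZero m] :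
    (((x % (m : ℤ)).toNat : ℕ) : ZMod m) = (x : ZMod m) := by
  have h0 : 0 ≤ x % (m : ℤ) := Int.emod_nonneg _ (by exact_mod_cast (NeZero.ne m))
  have h1 : (((x % (m : ℤ)).toNat : ℕ) : ℤ) = x % (m : ℤ) := Int.toNat_of_nonneg h0
  have h2 : (((x % (m : ℤ)).toNat : ℕ) : ZMod m) = ((((x % (m : ℤ)).toNat : ℕ) : ℤ) : ZMod m) :=
    (Int.cast_natCast _).symm
  rw [h2, h1, ZMod.intCast_mod]

/-- **The board determines the output**: two inputs with the same step-1 announcement and the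
same step-2 numbers have the same number of good columns (mod `n + 1`, hence exactly), so
the same value of `f ∘ g⃗` for symmetric `f`. [cite: AdaEtAl2014, proof of Thm. 2(a) (PDF pp. 6–7)] -/
theorem composeNOF_eq_of_msgA_eq (f : (Fin n → Bool) → Bool) (hf : IsSymmetricFn f)
    (g : Fin n → (Fin (K + 2) → Bool) → Bool) (X X' : NOFInput (K + 2) n)
    (ha : annA X = annA X') (hmsg : ∀ p, msgA g (annA X) p X = msgA g (annA X) p X') :
    composeNOF f g X = composeNOF f g X' := by
  have hT : ∀ Y : NOFInput (K + 2) n,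
      decodeSet (annA Y).2 = univ.filter fun j => tailCol Y j = (annA Y).1 :=
    fun Y => decodeSet_encodeSet _ (card_rareSet_le Y)
  have hS := sum_msgAInt g X (annA X) (hT X)
  have hS' := sum_msgAInt g X' (annA X) (by rw [ha]; exact hT X')
  have hz : ∀ p, (msgAInt g (annA X) p X : ZMod (n + 1)) = (msgAInt g (annA X) p X' : ZMod (n + 1)) := by
    intro p
    have h := congrArg (fun t : ℕ => (t : ZMod (n + 1))) (hmsg p)
    simpa only [msgA, natCast_toNat_emod] using h
  have hsum : ((∑ j, (if g j (col X j) = true then (1 : ℤ) else 0) : ℤ) : ZMod (n + 1)) =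
      ((∑ j, (if g j (col X' j) = true then (1 : ℤ) else 0) : ℤ) : ZMod (n + 1)) := by
    rw [← hS, ← hS', Int.cast_sum, Int.cast_sum]
    exact Finset.sum_congr rfl fun p _ => hz p
  rw [← Finset.natCast_card_filter, ← Finset.natCast_card_filter, Int.cast_natCast,
    Int.cast_natCast, ZMod.natCast_eq_natCast_iff'] at hsum
  have hA : (univ.filter fun j => g j (col X j) = true).card ≤ n :=
    (card_filter_le _ _).trans (by simp)
  have hA' : (univ.filter fun j => g j (col X' j) = true).card ≤ n :=
    (card_filter_le _ _).trans (by simp)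
  rw [Nat.mod_eq_of_lt (Nat.lt_succ_of_le hA), Nat.mod_eq_of_lt (Nat.lt_succ_of_le hA')] at hsum
  exact hf _ _ hsum

/-- **ACFN Theorem 2(a), protocol form with explicit cost.** For `k = K + 2 ≥ 2` players, every
`f ∘ g⃗` with `f` symmetric has a valid deterministic NOF protocol of cost
`(k-1) + ⌈log₂(n+1)⌉ · ⌊n/2^{k-1}⌋ + k · ⌈log₂(n+1)⌉` (`Nat.size n = ⌈log₂(n+1)⌉`): player `0`
announces the least frequent tail and its columns, then every player announces her part of
the count mod `n + 1`. [cite: AdaEtAl2014, Thm. 2(a) (PDF p. 6; full version ECCC TR11-155, Thm. 3.2(a), pp. 10–12)] -/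
theorem hasNOFProtocol_composeNOF (K n : ℕ) (f : (Fin n → Bool) → Bool) (hf : IsSymmetricFn f)
    (g : Fin n → (Fin (K + 2) → Bool) → Bool) :
    HasNOFProtocol (composeNOF f g)
      ((K + 1) + Nat.size n * (n / 2 ^ (K + 1)) + (K + 2) * Nat.size n) :=
  hasNOFProtocol_of_determined₂ (composeNOF f g) 0 _ _ (card_annType_le K n) annA
    (fun X r => annA_update_zero X r) (msgA g) (fun a p => msgA_indep g a p)
    (fun a p X => lt_of_lt_of_le (msgA_lt g a p X) (Nat.lt_size_self n))
    (fun X X' ha hm => composeNOF_eq_of_msgA_eq f hf g X X' ha hm)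

end PartA

/-! ### Parts (b) and (c): the simultaneous protocols (only the first `ℓ` players speak) -/

section PartBC

variable {k n ℓ : ℕ}

/-- The head of column `j`: its entries in the `ℓ` speaking rows.
[cite: AdaEtAl2014, proof of Thm. 2(c) (PDF p. 7)] -/
def head (hℓ : ℓ ≤ k) (X : NOFInput k n) (j : Fin n) : Fin ℓ → Bool :=
  fun q => X (Fin.castLE hℓ q) j

/-- Column `j` with its head replaced by `v` (the rows `≥ ℓ` are seen by every speaker).
[cite: AdaEtAl2014, proof of Thm. 2(c) (PDF p. 7)] -/
def glueCol (X : NOFInput k n) (j : Fin n) (v : Fin ℓ → Bool) : Fin k → Bool :=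
  fun i => if h : (i : ℕ) < ℓ then v ⟨i, h⟩ else X i j

/-- **The induced inner function** `g'_j(v) = g_j(v · (rows ℓ+1 … k of column j))`.
[cite: AdaEtAl2014, proof of Thm. 2(c) (PDF p. 7; full version ECCC TR11-155, p. 12)] -/
def innerFn (g : Fin n → (Fin k → Bool) → Bool) (X : NOFInput k n) (j : Fin n) :
    (Fin ℓ → Bool) → Bool :=
  fun v => g j (glueCol X j v)

/-- Gluing the true head back gives the column. [folklore] -/
theorem glueCol_head (hℓ : ℓ ≤ k) (X : NOFInput k n) (j : Fin n) :
    glueCol X j (head hℓ X j) = col X j := by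
  funext i
  unfold glueCol head col
  split_ifs with h
  · have : Fin.castLE hℓ ⟨i, h⟩ = i := Fin.ext rfl
    rw [this]
  · rfl

/-- Changing speaker `p`'s row does not change the other head entries. [folklore] -/
theorem head_update_of_ne (hℓ : ℓ ≤ k) (X : NOFInput k n) {p q : Fin ℓ} (hq : q ≠ p)
    (r : Fin n → Bool) (j : Fin n) :
    head hℓ (Function.update X (Fin.castLE hℓ p) r) j q = head hℓ X j q := by
  unfold head
  rw [Function.update_of_ne]
  exact fun h => hq (Fin.castLE_injective hℓ h)

/-- Glued columns do not depend on the speakers' rows. [folklore] -/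
theorem glueCol_update (hℓ : ℓ ≤ k) (X : NOFInput k n) (p : Fin ℓ) (r : Fin n → Bool)
    (j : Fin n) (v : Fin ℓ → Bool) :
    glueCol (Function.update X (Fin.castLE hℓ p) r) j v = glueCol X j v := by
  funext i
  unfold glueCol
  split_ifs with h
  · rfl
  · rw [Function.update_of_ne]
    intro hi
    apply h
    rw [hi]
    exact p.2

/-- The induced inner functions do not depend on the speakers' rows (every speaker knows them).
[cite: AdaEtAl2014, proof of Thm. 2(c) (PDF p. 7)] -/
theorem innerFn_update (hℓ : ℓ ≤ k) (g : Fin n → (Fin k → Bool) → Bool) (X : NOFInput k n)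
    (p : Fin ℓ) (r : Fin n → Bool) (j : Fin n) :
    innerFn (ℓ := ℓ) g (Function.update X (Fin.castLE hℓ p) r) j = innerFn g X j := by
  funext v
  simp only [innerFn, glueCol_update hℓ]

/-- **Speaker `p`'s part** (with `u = 0⃗`, summed over all columns): an integer she can compute.
[cite: AdaEtAl2014, proof of Thm. 2(c) (PDF p. 7; full version p. 12, eqs. (5)–(6))] -/
def partBC (hℓ : ℓ ≤ k) (g : Fin n → (Fin k → Bool) → Bool) (p : Fin ℓ) (X : NOFInput k n) : ℤ :=
  ∑ j, edgePart (fun _ => false) (innerFn g X j) p (head hℓ X j)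

/-- Speaker `p`'s part does not depend on row `p`. [cite: AdaEtAl2014, proof of Thm. 2(c) (PDF p. 7)] -/
theorem partBC_indep (hℓ : ℓ ≤ k) (g : Fin n → (Fin k → Bool) → Bool) (p : Fin ℓ) :
    IndepOfRow (Fin.castLE hℓ p) (partBC hℓ g p) := by
  intro X r
  unfold partBC
  refine Finset.sum_congr rfl fun j _ => ?_
  rw [innerFn_update hℓ]
  exact edgePart_congr _ _ _ fun q hq => head_update_of_ne hℓ X hq r j

/-- The correction term `Σ_j c_j 1_j(0⃗)` (before reduction): the coefficients `ĉ_j` of the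
all-zero heads. [cite: AdaEtAl2014, proof of Thm. 2(c) (full version ECCC TR11-155, p. 12)] -/
def corrBC (hℓ : ℓ ≤ k) (g : Fin n → (Fin k → Bool) → Bool) (X : NOFInput k n) : ℤ :=
  ∑ j, topCoeff (fun _ : Fin ℓ => false) (innerFn g X j) *
    (if head hℓ X j = (fun _ => false) then 1 else 0)

/-- **Summing the speakers' parts**: the number of good columns minus the correction term
(ACFN eq. (6) substituted into (5)). [cite: AdaEtAl2014, proof of Thm. 2(c) (full version p. 12)] -/
theorem sum_partBC (hℓ : ℓ ≤ k) (g : Fin n → (Fin k → Bool) → Bool) (X : NOFInput k n) :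
    ∑ p, partBC hℓ g p X =
      (∑ j, (if g j (col X j) = true then (1 : ℤ) else 0)) - corrBC hℓ g X := by
  unfold partBC corrBC
  rw [Finset.sum_comm]
  simp_rw [sum_edgePart]
  rw [Finset.sum_sub_distrib]
  congr 1
  refine Finset.sum_congr rfl fun j _ => ?_
  simp only [innerFn, glueCol_head]

/-- Speaker `p`'s weighted column statistics (Lemma 3.1 run on the duplicated matrix `X'`):
for each `w`, the total weight of the columns whose head shows weight `w` to her.
[cite: AdaEtAl2014, Lemma 2 and proof of Thm. 2(c) (PDF pp. 6–7)] -/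
def statBC (hℓ : ℓ ≤ k) (c : NOFInput k n → Fin n → ℕ) (p : Fin ℓ) (X : NOFInput k n)
    (w : ℕ) : ℕ :=
  ∑ j ∈ univ.filter (fun j => wtErase p (head hℓ X j) = w), c X j

/-- Speaker `p`'s message: her part mod `n + 1` and her `ℓ` statistics.
[cite: AdaEtAl2014, proof of Thm. 2(b),(c) (PDF p. 7)] -/
def msgBC (hℓ : ℓ ≤ k) (g : Fin n → (Fin k → Bool) → Bool) (c : NOFInput k n → Fin n → ℕ)
    (p : Fin ℓ) (X : NOFInput k n) : Option (Fin ℓ) → ℕ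
  | none => Int.toNat (partBC hℓ g p X % ((n + 1 : ℕ) : ℤ))
  | some w => statBC hℓ c p X w

/-- **The simultaneous engine (proof of Thm. 2(b),(c)).** Let the first `ℓ ≥ 1` of the `k`
players speak, and let `c_j(X) ∈ ℕ` be column multiplicities that the speakers all know
(they depend on the rows `≥ ℓ` only), of total `< 2^{ℓ-1}` ("`ℓ > 1 + log`(number of columns of
`X'`)"), such that the weighted number of all-zero heads determines the correction term mod
`n + 1`. Then the messages "my part mod `n + 1`" and "my weighted statistics" (numbers `< 2^B`)
determine `f ∘ g⃗`, so `D_k^∥(f ∘ g⃗) ≤ ℓ (ℓ + 1) B`.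
[cite: AdaEtAl2014, proof of Thm. 2(b),(c) (PDF p. 7; full version ECCC TR11-155, Thm. 3.2, p. 12)] -/
theorem hasSimultaneousProtocol_engine {B W : ℕ} (hℓ : ℓ ≤ k) (hℓ1 : 1 ≤ ℓ)
    (f : (Fin n → Bool) → Bool) (hf : IsSymmetricFn f) (g : Fin n → (Fin k → Bool) → Bool)
    (c : NOFInput k n → Fin n → ℕ)
    (hc1 : ∀ (p : Fin ℓ) (X : NOFInput k n) (r : Fin n → Bool) (j : Fin n),
      c (Function.update X (Fin.castLE hℓ p) r) j = c X j)
    (hc2 : ∀ X, ∑ j, c X j ≤ W) (hW : W < 2 ^ (ℓ - 1)) (hWB : W < 2 ^ B) (hnB : n < 2 ^ B)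
    (hc3 : ∀ X X' : NOFInput k n,
      ∑ j ∈ univ.filter (fun j => head hℓ X j = fun _ => false), c X j =
        ∑ j ∈ univ.filter (fun j => head hℓ X' j = fun _ => false), c X' j →
      (corrBC hℓ g X : ZMod (n + 1)) = corrBC hℓ g X') :
    HasSimultaneousProtocol (composeNOF f g) (ℓ * ((ℓ + 1) * B)) := by
  have hcard : Fintype.card (Option (Fin ℓ)) = ℓ + 1 := by simp
  rw [← hcard]
  refine hasSimultaneousProtocol_of_determined hℓ (composeNOF f g) (msgBC hℓ g c) ?_ ?_ ?_
  · -- messages do not depend on the speaker's row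
    intro p X r
    funext a
    cases a with
    | none =>
      simp only [msgBC]
      rw [partBC_indep hℓ g p X r]
    | some w =>
      simp only [msgBC, statBC]
      rw [Finset.sum_congr rfl fun j _ => hc1 p X r j]
      congr 1
      refine Finset.filter_congr fun j _ => ?_
      rw [wtErase_congr p fun q hq => head_update_of_ne hℓ X hq r j]
  · -- messages are numbers `< 2^B`
    intro p X a
    cases a with
    | none =>
      simp only [msgBC]
      have h0 : (0 : ℤ) < ((n + 1 : ℕ) : ℤ) := by positivity
      have h1 := Int.emod_nonneg (partBC hℓ g p X) h0.ne'
      have h2 := Int.emod_lt_of_pos (partBC hℓ g p X) h0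
      have h3 : n + 1 ≤ 2 ^ B := hnB
      omega
    | some w =>
      simp only [msgBC, statBC]
      calc ∑ j ∈ univ.filter (fun j => wtErase p (head hℓ X j) = w), c X j ≤ ∑ j, c X j :=
            Finset.sum_le_sum_of_subset (filter_subset _ _)
        _ ≤ W := hc2 X
        _ < 2 ^ B := hWB
  · -- the messages determine the value
    intro X X' hm
    have hz : ∀ p, (partBC hℓ g p X : ZMod (n + 1)) = (partBC hℓ g p X' : ZMod (n + 1)) := by
      intro p
      have h := congrArg (fun t : ℕ => (t : ZMod (n + 1))) (congrFun (hm p) none)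
      simpa only [msgBC, natCast_toNat_emod] using h
    have hstat : ∀ (p : Fin ℓ) (w : ℕ), statBC hℓ c p X w = statBC hℓ c p X' w := by
      intro p w
      by_cases hw : w < ℓ
      · exact congrFun (hm p) (some ⟨w, hw⟩)
      · have hempty : ∀ Y : NOFInput k n,
            (univ.filter fun j => wtErase p (head hℓ Y j) = w) = ∅ := by
          intro Y
          rw [Finset.filter_eq_empty_iff]
          intro j _ h
          exact hw (h ▸ wtErase_lt p (head hℓ Y j))
        simp only [statBC, hempty, Finset.sum_empty]
    have h0 := bgkl_unique hℓ1 (head hℓ X) (c X) (head hℓ X') (c X')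
      (lt_of_le_of_lt (hc2 X) hW) (lt_of_le_of_lt (hc2 X') hW) hstat 0
    have hfilt : ∀ Y : NOFInput k n, (univ.filter fun j => wt (head hℓ Y j) = 0) =
        univ.filter fun j => head hℓ Y j = fun _ => false := fun Y =>
      Finset.filter_congr fun j _ => wt_eq_zero_iff _
    rw [hfilt, hfilt] at h0
    have hcorr := hc3 X X' h0
    have hS := sum_partBC hℓ g X
    have hS' := sum_partBC hℓ g X'
    have hsum : ((∑ j, (if g j (col X j) = true then (1 : ℤ) else 0) : ℤ) : ZMod (n + 1)) =
        ((∑ j, (if g j (col X' j) = true then (1 : ℤ) else 0) : ℤ) : ZMod (n + 1)) := by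
      rw [eq_sub_iff_add_eq] at hS hS'
      rw [← hS, ← hS', Int.cast_add, Int.cast_add, Int.cast_sum, Int.cast_sum, hcorr,
        Finset.sum_congr rfl fun p _ => hz p]
    rw [← Finset.natCast_card_filter, ← Finset.natCast_card_filter, Int.cast_natCast,
      Int.cast_natCast, ZMod.natCast_eq_natCast_iff'] at hsum
    have hA : (univ.filter fun j => g j (col X j) = true).card ≤ n :=
      (card_filter_le _ _).trans (by simp)
    have hA' : (univ.filter fun j => g j (col X' j) = true).card ≤ n :=
      (card_filter_le _ _).trans (by simp)
    rw [Nat.mod_eq_of_lt (Nat.lt_succ_of_le hA), Nat.mod_eq_of_lt (Nat.lt_succ_of_le hA')] at hsum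
    exact hf _ _ hsum

/-- **ACFN Theorem 2(c), protocol form with explicit cost.** With `ℓ = ⌈log₂(n²+1)⌉ + 1 ≤ k`
speakers (i.e. `k > 1 + 2 log₂ n`), `f ∘ g⃗` has a valid simultaneous protocol of cost
`ℓ (ℓ + 1) ⌈log₂(n²+1)⌉ = O(log³ n)`: multiplicities `c_j = ĉ_j mod (n+1) ≤ n`, total `≤ n²`.
[cite: AdaEtAl2014, Thm. 2(c) (PDF pp. 6–7; full version ECCC TR11-155, Thm. 3.2(c), p. 12)] -/
theorem hasSimultaneousProtocol_composeNOF_vec (k n : ℕ) (hk : Nat.size (n * n) + 1 ≤ k)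
    (f : (Fin n → Bool) → Bool) (hf : IsSymmetricFn f) (g : Fin n → (Fin k → Bool) → Bool) :
    HasSimultaneousProtocol (composeNOF f g)
      ((Nat.size (n * n) + 1) * ((Nat.size (n * n) + 1 + 1) * Nat.size (n * n))) := by
  set ℓ := Nat.size (n * n) + 1 with hℓdef
  have hℓ : ℓ ≤ k := hk
  let c : NOFInput k n → Fin n → ℕ := fun X j =>
    Int.toNat (topCoeff (fun _ : Fin ℓ => false) (innerFn g X j) % ((n + 1 : ℕ) : ℤ))
  have hcle : ∀ X j, c X j ≤ n := by
    intro X j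
    have h0 : (0 : ℤ) < ((n + 1 : ℕ) : ℤ) := by positivity
    have h1 := Int.emod_nonneg (topCoeff (fun _ : Fin ℓ => false) (innerFn g X j)) h0.ne'
    have h2 := Int.emod_lt_of_pos (topCoeff (fun _ : Fin ℓ => false) (innerFn g X j)) h0
    simp only [c]
    omega
  refine hasSimultaneousProtocol_engine (W := n * n) hℓ (by omega) f hf g c ?_ ?_ ?_ ?_ ?_ ?_
  · intro p X r j
    simp only [c, innerFn_update hℓ]
  · intro X
    calc ∑ j, c X j ≤ ∑ _j : Fin n, n := Finset.sum_le_sum fun j _ => hcle X j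
      _ = n * n := by simp
  · rw [hℓdef, Nat.add_sub_cancel]
    exact Nat.lt_size_self _
  · exact Nat.lt_size_self _
  · exact lt_of_le_of_lt (Nat.le_mul_self n) (Nat.lt_size_self _)
  · intro X X' h
    have hcast : ∀ Y : NOFInput k n, (corrBC hℓ g Y : ZMod (n + 1)) =
        ((∑ j ∈ univ.filter (fun j => head hℓ Y j = fun _ => false), c Y j : ℕ) : ZMod (n + 1)) := by
      intro Y
      unfold corrBC
      rw [Int.cast_sum, Nat.cast_sum, Finset.sum_filter]
      refine Finset.sum_congr rfl fun j _ => ?_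
      rw [Int.cast_mul]
      split_ifs with hj
      · rw [Int.cast_one, mul_one]
        simp only [c]
        rw [natCast_toNat_emod]
      · rw [Int.cast_zero, mul_zero]
    rw [hcast, hcast, h]

/-- When all `k` players speak and the inner function is the same `g` for every column, the
induced inner functions are all `g` (so the coefficients `c_j = c` coincide).
[cite: AdaEtAl2014, proof of Thm. 2(b) (full version ECCC TR11-155, p. 12)] -/
theorem innerFn_const_self (g : (Fin k → Bool) → Bool) (X : NOFInput k n) (j : Fin n) :
    innerFn (ℓ := k) (fun _ => g) X j = g := by
  funext v
  show g (glueCol X j v) = g v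
  congr 1
  funext i
  unfold glueCol
  rw [dif_pos i.2]

/-- **ACFN Theorem 2(b), protocol form with explicit cost, few players.** For a single inner
function `g` and `n < 2^{k-1}` (i.e. `k > 1 + log₂ n`), all `k` players speak: `f ∘ g` has a
valid simultaneous protocol of cost `k (k + 1) ⌈log₂(n+1)⌉` (unit multiplicities: the
coefficient `ĉ` is the same for every column, so only `n_{0⃗}` is needed).
[cite: AdaEtAl2014, Thm. 2(b) (PDF pp. 6–7; full version ECCC TR11-155, Thm. 3.2(b), p. 12)] -/
theorem hasSimultaneousProtocol_composeNOF_single (k n : ℕ) (hk : 1 ≤ k) (hn : n < 2 ^ (k - 1))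
    (f : (Fin n → Bool) → Bool) (hf : IsSymmetricFn f) (g : (Fin k → Bool) → Bool) :
    HasSimultaneousProtocol (composeNOF f fun _ => g) (k * ((k + 1) * Nat.size n)) := by
  refine hasSimultaneousProtocol_engine (W := n) le_rfl hk f hf (fun _ => g) (fun _ _ => 1)
    (fun _ _ _ _ => rfl) (fun X => by simp) hn (Nat.lt_size_self n) (Nat.lt_size_self n) ?_
  intro X X' h
  simp only [Finset.sum_const, smul_eq_mul, mul_one] at h
  unfold corrBC
  simp only [innerFn_const_self]
  rw [← Finset.mul_sum, ← Finset.mul_sum, Finset.sum_boole, Finset.sum_boole]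
  push_cast
  rw [h]

end PartBC

/-! ### The barrier fact: from bit counts to `O(·)` with `log₂` (constant `c = 64`) -/

section Holds

/-- `log₂ n ≥ 1` for `n ≥ 2`. [folklore] -/
theorem one_le_logb_two (n : ℕ) (hn : 2 ≤ n) : 1 ≤ Real.logb 2 n := by
  rw [Real.le_logb_iff_rpow_le (by norm_num) (by positivity), Real.rpow_one]
  exact_mod_cast hn

/-- `⌈log₂(m+1)⌉ ≤ log₂ m + 1`. [folklore] -/
theorem natSize_le_logb (m : ℕ) (hm : 1 ≤ m) : (Nat.size m : ℝ) ≤ Real.logb 2 m + 1 := by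
  have h1 : Nat.size m ≤ Nat.log 2 m + 1 := Nat.size_le.2 (Nat.lt_pow_succ_log_self one_lt_two m)
  have h2 : (Nat.log 2 m : ℝ) ≤ Real.logb 2 m := by
    rw [Real.le_logb_iff_rpow_le (by norm_num) (by exact_mod_cast (show 0 < m by omega)),
      Real.rpow_natCast]
    exact_mod_cast Nat.pow_log_le_self 2 (show m ≠ 0 by omega)
  calc (Nat.size m : ℝ) ≤ ((Nat.log 2 m + 1 : ℕ) : ℝ) := by exact_mod_cast h1
    _ = Nat.log 2 m + 1 := by push_cast; ring
    _ ≤ Real.logb 2 m + 1 := by linarith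

/-- `log₂ (n²) = 2 log₂ n`. [folklore] -/
theorem logb_two_mul_self (n : ℕ) : Real.logb 2 ((n * n : ℕ) : ℝ) = 2 * Real.logb 2 n := by
  push_cast
  rw [← pow_two, Real.logb_pow]
  push_cast
  ring

/-- `k > 1 + log₂ n` means `n < 2^{k-1}`. [folklore] -/
theorem lt_pow_of_logb_lt (n k : ℕ) (hk : 1 ≤ k) (hn : 1 ≤ n) (h : 1 + Real.logb 2 n < k) :
    n < 2 ^ (k - 1) := by
  have h' : Real.logb 2 n < ((k - 1 : ℕ) : ℝ) := by
    rw [Nat.cast_sub hk]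
    push_cast
    linarith
  rw [Real.logb_lt_iff_lt_rpow (by norm_num) (by exact_mod_cast (show 0 < n by omega)),
    Real.rpow_natCast] at h'
  exact_mod_cast h'

/-- `k > 1 + 2 log₂ n` means `n² < 2^{k-1}`. [folklore] -/
theorem mul_self_lt_pow_of_logb_lt (n k : ℕ) (hk : 1 ≤ k) (hn : 1 ≤ n)
    (h : 1 + 2 * Real.logb 2 n < k) : n * n < 2 ^ (k - 1) := by
  refine lt_pow_of_logb_lt (n * n) k hk (by nlinarith) ?_
  rw [logb_two_mul_self]
  exact h

/-- `2^{k-1} ≤ n²` means `k ≤ 2 log₂ n + 1`. [folklore] -/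
theorem le_logb_of_pow_le (n k : ℕ) (hk : 1 ≤ k) (hn : 1 ≤ n) (h : 2 ^ (k - 1) ≤ n * n) :
    (k : ℝ) ≤ 2 * Real.logb 2 n + 1 := by
  have h' : ((k - 1 : ℕ) : ℝ) ≤ Real.logb 2 ((n * n : ℕ) : ℝ) := by
    rw [Real.le_logb_iff_rpow_le (by norm_num) (by exact_mod_cast (show 0 < n * n by nlinarith)),
      Real.rpow_natCast]
    exact_mod_cast h
  rw [logb_two_mul_self, Nat.cast_sub hk] at h'
  push_cast at h'
  linarith

/-- Cost bookkeeping for part (a): `(k-1) + ⌈log₂(n+1)⌉⌊n/2^{k-1}⌋ + k⌈log₂(n+1)⌉ ≤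
64 (n/2^k · log₂ n + k log₂ n)`. [cite: AdaEtAl2014, Thm. 2(a) (PDF p. 6)] -/
theorem costA_le (K n C : ℕ) (hn : 2 ≤ n)
    (hC : C ≤ (K + 1) + Nat.size n * (n / 2 ^ (K + 1)) + (K + 2) * Nat.size n) :
    (C : ℝ) ≤ 64 * ((n : ℝ) / 2 ^ (K + 2) * Real.logb 2 n + ((K + 2 : ℕ) : ℝ) * Real.logb 2 n) := by
  have L1 := one_le_logb_two n hn
  have hs := natSize_le_logb n (by omega)
  set L := Real.logb 2 n with hL
  set s := (Nat.size n : ℝ) with hsdef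
  set D := ((n / 2 ^ (K + 1) : ℕ) : ℝ) with hDdef
  set A := (n : ℝ) / 2 ^ (K + 2) with hA
  have hC' : (C : ℝ) ≤ (K + 1) + s * D + (K + 2) * s := by
    have := (Nat.cast_le (α := ℝ)).2 hC
    push_cast at this
    exact this
  have hD : D ≤ 2 * A := by
    calc D ≤ (n : ℝ) / ((2 ^ (K + 1) : ℕ) : ℝ) := by
          rw [hDdef]
          exact Nat.cast_div_le
      _ = (n : ℝ) / 2 ^ (K + 1) := by push_cast; ring
      _ = 2 * A := by
          rw [hA, pow_succ]
          field_simp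
          ring
  have hD0 : 0 ≤ D := Nat.cast_nonneg _
  have hs0 : 0 ≤ s := Nat.cast_nonneg _
  have hA0 : 0 ≤ A := by positivity
  have hs2 : s ≤ 2 * L := by linarith
  have h1 : s * D ≤ (2 * L) * (2 * A) := mul_le_mul hs2 hD hD0 (by linarith)
  have h2 : ((K : ℝ) + 2) * s ≤ (K + 2) * (2 * L) := mul_le_mul_of_nonneg_left hs2 (by positivity)
  have h3 : (K : ℝ) + 1 ≤ (K + 2) * L := by nlinarith
  have h4 : 0 ≤ A * L := mul_nonneg hA0 (by linarith)
  have h5 : 0 ≤ ((K : ℝ) + 2) * L := by positivity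
  push_cast
  nlinarith

/-- Cost bookkeeping for parts (b) (many players) and (c):
`ℓ (ℓ+1) ⌈log₂(n²+1)⌉ ≤ 64 log₂³ n` for `ℓ = ⌈log₂(n²+1)⌉ + 1`. [cite: AdaEtAl2014, Thm. 2(b),(c) (PDF p. 6)] -/
theorem costC_le (n C : ℕ) (hn : 2 ≤ n)
    (hC : C ≤ (Nat.size (n * n) + 1) * ((Nat.size (n * n) + 1 + 1) * Nat.size (n * n))) :
    (C : ℝ) ≤ 64 * Real.logb 2 n ^ 3 := by
  have L1 := one_le_logb_two n hn
  have hs : (Nat.size (n * n) : ℝ) ≤ 2 * Real.logb 2 n + 1 := by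
    have := natSize_le_logb (n * n) (by nlinarith)
    rw [logb_two_mul_self] at this
    exact this
  set s := (Nat.size (n * n) : ℝ) with hsdef
  set L := Real.logb 2 n with hL
  have hC' : (C : ℝ) ≤ (s + 1) * ((s + 1 + 1) * s) := by
    have := (Nat.cast_le (α := ℝ)).2 hC
    push_cast at this
    exact this
  have hs0 : 0 ≤ s := Nat.cast_nonneg _
  have h1 : s ≤ 3 * L := by linarith
  have h2 : s + 1 ≤ 4 * L := by linarith
  have h3 : s + 1 + 1 ≤ 5 * L := by linarith
  calc (C : ℝ) ≤ (s + 1) * ((s + 1 + 1) * s) := hC'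
    _ ≤ (4 * L) * ((5 * L) * (3 * L)) :=
        mul_le_mul h2 (mul_le_mul h3 h1 hs0 (by linarith)) (by positivity) (by linarith)
    _ = 60 * L ^ 3 := by ring
    _ ≤ 64 * L ^ 3 := by nlinarith [pow_pos (show (0 : ℝ) < L by linarith) 3]

/-- Cost bookkeeping for part (b) (few players, `k ≤ ⌈log₂(n²+1)⌉`):
`k (k+1) ⌈log₂(n+1)⌉ ≤ 64 log₂³ n`. [cite: AdaEtAl2014, Thm. 2(b) (PDF p. 6)] -/
theorem costB_le (n k C : ℕ) (hn : 2 ≤ n) (hk : k ≤ Nat.size (n * n))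
    (hC : C ≤ k * ((k + 1) * Nat.size n)) : (C : ℝ) ≤ 64 * Real.logb 2 n ^ 3 := by
  have L1 := one_le_logb_two n hn
  have hs2 : (Nat.size (n * n) : ℝ) ≤ 2 * Real.logb 2 n + 1 := by
    have := natSize_le_logb (n * n) (by nlinarith)
    rw [logb_two_mul_self] at this
    exact this
  have hs := natSize_le_logb n (by omega)
  set L := Real.logb 2 n with hL
  set s := (Nat.size n : ℝ) with hsdef
  have hk' : (k : ℝ) ≤ 2 * L + 1 := le_trans (by exact_mod_cast hk) hs2
  have hC' : (C : ℝ) ≤ k * ((k + 1) * s) := by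
    have := (Nat.cast_le (α := ℝ)).2 hC
    push_cast at this
    exact this
  have hs0 : 0 ≤ s := Nat.cast_nonneg _
  have hk0 : (0 : ℝ) ≤ k := Nat.cast_nonneg _
  have h1 : (k : ℝ) ≤ 3 * L := by linarith
  have h2 : (k : ℝ) + 1 ≤ 4 * L := by linarith
  have h3 : s ≤ 2 * L := by linarith
  calc (C : ℝ) ≤ k * ((k + 1) * s) := hC'
    _ ≤ (3 * L) * ((4 * L) * (2 * L)) :=
        mul_le_mul h1 (mul_le_mul h2 h3 hs0 (by linarith)) (by positivity) (by linarith)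
    _ = 24 * L ^ 3 := by ring
    _ ≤ 64 * L ^ 3 := by nlinarith [pow_pos (show (0 : ℝ) < L by linarith) 3]

end Holds

end ACFN

open ACFN in
/-- **Ada–Chattopadhyay–Fawzi–Nguyen, Theorem 2 — the barrier fact `NOFLogNBarrier`,
discharged** (with the absolute constant `c = 64`): (a) from `hasNOFProtocol_composeNOF`
(Grolmusz's protocol: least frequent tail + telescoping parts mod `n + 1`), (b) from
`hasSimultaneousProtocol_composeNOF_single` when `k ≤ ⌈log₂(n²+1)⌉` and from (c) otherwise,
(c) from `hasSimultaneousProtocol_composeNOF_vec` (first `⌈log₂(n²+1)⌉ + 1` players, parts mod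
`n + 1` plus Babai–Gál–Kimmel–Lokam statistics of the duplicated matrix, `bgkl_unique`).
[cite: AdaEtAl2014, Thm. 2 (PDF p. 6; full version ECCC TR11-155, Thm. 3.2, pp. 10–12)] -/
theorem NOFLogNBarrier_holds : NOFLogNBarrier := by
  refine ⟨64, by norm_num, fun k n hk hn f hf => ⟨?_, ?_, ?_⟩⟩
  · -- (a): deterministic protocols for every `k ≥ 2`
    intro g
    obtain ⟨K, rfl⟩ : ∃ K, k = K + 2 := ⟨k - 2, by omega⟩
    obtain ⟨P, hv, hc, he⟩ := hasNOFProtocol_composeNOF K n f hf g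
    exact ⟨P, hv, he, costA_le K n P.cost hn hc⟩
  · -- (b): simultaneous protocols for `f ∘ g` when `k > 1 + log₂ n`
    intro hlog g
    by_cases hcase : Nat.size (n * n) + 1 ≤ k
    · obtain ⟨S, hv, hc, he⟩ := hasSimultaneousProtocol_composeNOF_vec k n hcase f hf (fun _ => g)
      exact ⟨S, hv, he, costC_le n S.cost hn hc⟩
    · have hn' : n < 2 ^ (k - 1) := lt_pow_of_logb_lt n k (by omega) (by omega) hlog
      obtain ⟨S, hv, hc, he⟩ := hasSimultaneousProtocol_composeNOF_single k n (by omega) hn' f hf g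
      exact ⟨S, hv, he, costB_le n k S.cost hn (by omega) hc⟩
  · -- (c): simultaneous protocols for `f ∘ g⃗` when `k > 1 + 2 log₂ n`
    intro hlog g
    have hsq : n * n < 2 ^ (k - 1) := mul_self_lt_pow_of_logb_lt n k (by omega) (by omega) hlog
    have hcase : Nat.size (n * n) + 1 ≤ k := by
      have := Nat.size_le.2 hsq
      omega
    obtain ⟨S, hv, hc, he⟩ := hasSimultaneousProtocol_composeNOF_vec k n hcase f hf g
    exact ⟨S, hv, he, costC_le n S.cost hn hc⟩

end Literature.Barriers.PneNP
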